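import Mathlib
import HarnessLib
import HarnessLib.Audit
import Summits.FinalStateConjecture.Statement
import Literature.Geometry.Lorentzian.TrappedSurface
import Literature.Geometry.Lorentzian.EventHorizon
import Literature.Geometry.Lorentzian.KillingHorizonShadowAlong
import Literature.Geometry.Lorentzian.IPlusRegular
import HarnessLib.Audit.Status.Attr

/-!
Route: RootDecompHoleCountCells

# Route RootDecompHoleCountCells — Root decomposition N2c «HoleCountCells» (form b) —
TrappedBasinCells leaves by signature (single/multi/infinite-hole capture, naked, extremal,
threshold, dispersive exits); future-census cut of 26645

DECOMPOSITION CELL decomp-fsc (D-0178; doctrine D-0170/0171/0172), summit S =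
`_root_.FinalStateConjecture` exactly as typed; LADDER rung 0 — NOTHING IN THIS FILE PROVES THE
FINAL STATE CONJECTURE. THIN OR-SIBLING in FILING FORM (b) (critic standing rules 03:00:14Z /
03:45:00Z; CLEARED[split] 2026-08-30T04:18:58Z for lens-5 g4 «FutureCensusCarve») of
Theses/RootDecompTrappedBasinCells.lean (route-FinalStateConjecture-RootDecompTrappedBasinCells,
node N2b, rev 1 ebd2abfedf20: TrappedCaptureExit stmt-25597 split into SingleHoleCaptureExit 26645 ∧
MultiHoleCaptureExit 26646 ∧ InfiniteHoleCaptureExit 26647, glue 26648): this file = node N2c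
«HoleCountCells». The route is BORN with its top level BY SIGNATURE only — SingleHoleCaptureExit =
stmt-26645, MultiHoleCaptureExit = 26646, InfiniteHoleCaptureExit = 26647, TrappedNakedExit = 25598,
TrappedExtremalExit = 25599, ExtremalThresholdExit = 24765, DispersiveExit = 24766,
NakedThresholdExit = 24767 (kind support here ONLY to meet the gate cap of 7 cruxes per route —
per-route bookkeeping, it stays a crux on its home routes); `closes` over exactly these eight
(TrappedBasinCells' `closes` with 25597 rebuilt inline from its born children by two nested excluded
middles on «Single d» / «FinMany d»; folder/n2d/glue.lean, kernel-checked rc 0) — and the lens-5 g4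
cut is then filed ON THIS ROUTE as the GLUED SPLIT of SingleHoleCaptureExit (`--split
SingleHoleCaptureExit --into BoundedSingleExit CascadeSingleExit --glue 'BoundedSingleExit →
CascadeSingleExit → SingleHoleCaptureExit'`; x-caps max_depth 1 forbids it on TrappedBasinCells,
where 26645 is already a child). The cut (critic option (A) of OBJECTION 03:45:00Z, executed as
specified): CenFinF d := a BOUNDED pairwise-disjoint outermost-MOTS BODY census on FUTURE Cauchy
slices (range ι′ ⊆ J⁺(range 𝒟.embed), slice unbundled cast-free) of every MGHD — boundedness only,
never a census value; BoundedSingleExit = 26645 ∧ CenFinF (26645's residual RENAMED minus a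
conjecturally empty sliver · INTERNAL NODE · PARKED: no further cut without an attackable
norm-matched rung, which by caution c8 cannot be a Cauchy-window basin entry), CascadeSingleExit =
26645 ∧ ¬CenFinF (thin · BRIDGE ⟸ stmt-13847 CriticalAncestry.FiniteCensus, kernel-certified
cascadeSingleExit_of_finiteCensus modulo module availability · conjecturally VACUOUS · closes the
day 13847 closes); c5 annotation on both (body census undercounts holes on X with non-separating
spheres; harmless for the bridge since 13847 carries the same clause). DOMINATION POINTER: «26645 ⟺
BoundedSingleExit ∧ CascadeSingleExit (exact); CascadeSingleExit ⟸ 13847». The shelved γ-cut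
(Solo/Merger/Cascade by a PAST-slice census, folder/n2c) stays unfiled (OBJECTION 03:45:00Z O1–O4).
The whole AND/OR tree is kept in HOME/TREE.md (HOME = run/shared/lean/pub/decomp-fsc).
Lean: `SingleHoleCaptureExit ∧ MultiHoleCaptureExit ∧ InfiniteHoleCaptureExit ∧ TrappedNakedExit ∧
TrappedExtremalExit ∧ ExtremalThresholdExit ∧ DispersiveExit ∧ NakedThresholdExit` (the eight
by-signature decls of this file; `closes` in folder/n2d/glue.lean; the lens-5 g4 pieces enter as the
glued split of SingleHoleCaptureExit)

## Assembly
Pure logic inside `closes` (folder/n2d/glue.lean, 0 sorry; kernel-checked in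
folder/n2d/Sketch.lean): the born N2b case analysis (dispersive / trapped: P_w⁰, Cens / threshold:
P_w) with the capture cell 𝓣₂ (stmt-25597) rebuilt inline from its born children by two nested
excluded middles («Single d»; «FinMany d») = the proved shape of glue item stmt-26648.

Rationale: WHY THIS LINE. Population splits of the exceptional set are free and exact (critic
`fsc_iff_cellSplit`; tame genericity is monotone but not ∧-closed, tree
`isTameChristodoulouGeneric_and_fails`), hence judged on content, and this sibling exists for one
reason: to carry the critic-cleared FUTURE-CENSUS carve of the deepest trapped-side residual of the
tree (stmt-26645, one final hole) where the gate allows it (max_depth 1 on the home route). The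
carve isolates the ONLY place the census conjecture enters the trapped branch as ONE certified
implication — CascadeSingleExit ⟸ stmt-13847 FiniteCensus (route CriticalAncestry), kernel
`cascadeSingleExit_of_finiteCensus` (an unbundled future Cauchy slice of an MGHD is a
`CauchyDevelopment D′` with the same spacetime, so 13847's bound applies verbatim) — instead of
leaving it hidden inside every residual (census row RT7); the census, used elsewhere in the tree
only as an ∀-data HYPOTHESIS («finite ⟹ settles», stmt-13848), becomes a CELL BOUNDARY and assumes
nothing; it is cut by BOUNDEDNESS only, never by a census value (answers OBJECTION 03:45:00Z O3),
and only on slices in J⁺ of the data (O1). The complementary piece BoundedSingleExit is declared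
plainly as 26645's residual renamed (no endgame difficulty removed) and PARKED; the lens's finding,
adopted by the critic as caution c8 (radiation memory of i⁰-weighted Cauchy norms: late-slice
induced data of a radiating development never become Hˢ_δ-close to Kerr, arXiv:0811.0354 p.22,
arXiv:0910.4957 p.4, arXiv:2104.08222 p.3/p.100, arXiv:2104.11857 p.43/p.51), says why the honest
asymptotic-regime cut («the far future enters a Kerr-stability basin») must be typed on
𝓘⁺-transversal leaves (double-null seed energy / KS initial-data-layer norm) — definitions the tree
lacks (requests D1–D3 below). Imported from Lorentzian geometry: outermost MOTS / trapped region
structure (AnderssonMetzgerTrapped2009, Hawking–Ellis §9.2) as audited tree vocabulary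
(`OutermostMOTS`, `IsCauchyHypersurface`, `causalFuture`), and the characteristic/ layer stability
theorems DafermosHolzegelRodnianskiTaylor2021, KlainermanSzeftel2023 as the named tools of the
parked branch's future rung.

RANKED CRUXES. #2 SingleHoleCaptureExit (crux) — = the BORN gen-1 child
stmt-FinalStateConjecture-26645 of TrappedCaptureExit (stmt-25597) on
route-FinalStateConjecture-RootDecompTrappedBasinCells, reused BY SIGNATURE (dedup-attach; filing
form (b), critic CLEARED[split] 2026-08-30T04:18:58Z: this thin sibling is born with its top level
BY SIGNATURE only and the CLEARED lens-5 g4 cut «FutureCensusCarve» = critic option (A) of OBJECTION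
03:45:00Z (BoundedSingleExit ∧ CascadeSingleExit, exact free split by the bounded FUTURE-slice
outermost-MOTS body census CenFinF; lens kernel singleHoleCaptureExit_iff_cells BY NAME @c63b390e)
is filed ON THIS ROUTE as the glued split of this item immediately after birth); INTERNAL NODE; text
as born: [crux · child 𝓣₂¹ of TrappedCaptureExit · NEW RESIDUAL · GENERIC-TYPE; CLEARED by
decomp-fsc-crit-1-g0 2026-08-30T03:23:32Z (k = 3 chosen); writer glue/exactness
folder/n2bg3/Sketch.lean rc 0 / 0 sorry.] For every Σ and every admissible P_Σ-exceptional datum d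
of the capture cell 𝓣₂ (not of dispersive type; every MGHD contains a closed trapped sphere in the
causal future of the data; every MGHD has complete future null infinity; d fails the weak C⁰
property P_w⁰) ALL of whose MGHDs 𝒟 end with AT MOST ONE black hole — the future black-hole region
𝓑⁺(𝒟) = blackHoleRegion 𝒟 ∩ J⁺(range 𝒟.embed) (EventHorizon.lean vocabulary; = J⁺(ιΣ) minus
exteriorOf 𝒟 (completeNullRayRegion 𝒟)) has at most one connected component (Subsingleton
(ConnectedComponents ↥𝓑⁺), i.e. 𝓑⁺ preconnected; standing instance [HasLeviCivita] bound innermost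
as in CauchyDevelopment.lean) — there are one end e and a tame (order 1 at e), immersed-at-0,
injective one-parameter family F of admissible data with F 0 = d all of whose members c ≠ 0 satisfy
P_Σ. Content: the ONE-HOLE endgame at C⁰ (large-data capture of a single censored collapsed system,
rigidity of a connected-horizon stationary end state without analyticity, no eternally radiating
single exterior); relieved by construction of N-body recession, eternal binaries, multi-horizon
equilibria, cascades. Door: stmt-17296 ⟹ it outright
(HoleCountCells.singleHoleCaptureExit_of_censoredExteriorsSettle). [difficulty: open-problem] (why
it might fail: A tame-open set of trapped, censored admissible data forming ONE hole whose exterior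
never C⁰-settles to Kerr: smooth non-Kerr stationary hair with connected horizon (rigidity without
analyticity is open), or a non-decaying high-frequency tail (Burnett-type), would refute it.)
[arXiv:2606.28253, KlainermanSzeftel2023, GiorgiKlainermanSzeftel2022,
DafermosHolzegelRodnianskiTaylor2021, arXiv:0902.1173, arXiv:1710.01722, HawkingEllis1973]
#3 MultiHoleCaptureExit (crux) — = the BORN gen-1 child of TrappedCaptureExit (stmt-25597) on
route-FinalStateConjecture-RootDecompTrappedBasinCells, reused BY SIGNATURE; text as born: [crux ·
child 𝓣₂² of TrappedCaptureExit · SPECIAL-TYPE (configurational) · INSTRUMENTABLE; CLEARED by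
decomp-fsc-crit-1-g0 2026-08-30T03:23:32Z (k = 3 chosen); writer glue/exactness
folder/n2bg3/Sketch.lean rc 0 / 0 sorry.] For every Σ and every admissible P_Σ-exceptional datum d
of the capture cell 𝓣₂ (not of dispersive type; every MGHD contains a closed trapped sphere in the
causal future of the data; every MGHD has complete future null infinity; d fails the weak C⁰
property P_w⁰) SOME of whose MGHDs ends with AT LEAST TWO black holes (𝓑⁺ not preconnected) and ALL
of whose MGHDs end with FINITELY MANY (Finite (ConnectedComponents ↥𝓑⁺)), there are one end e and a
tame (order 1 at e), immersed-at-0, injective one-parameter family F of admissible … (full text as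
born on the home route) [difficulty: open-problem] (why it might fail: A tame-open set of admissible
data whose MGHD keeps two holes on an eternal quasi-periodic censored orbit (a vacuum 'floating'
binary), or n ≥ 3 co-axial multi-Kerr(–NUT) equilibria that exist AND are attained from an open set,
would refute it; n ≥ 3 non-existence is open (CCH12 p.14).) [doi:10.1007/BF00770326,
arXiv:0905.4179, arXiv:1103.5248, arXiv:1105.5830, arXiv:1111.1448, arXiv:0811.1727,
arXiv:1205.6112, arXiv:gr-qc/0210103, arXiv:2210.13960, arXiv:2001.10401, arXiv:1904.04831,
arXiv:0710.3823]
#4 InfiniteHoleCaptureExit (crux) — = the BORN gen-1 child of TrappedCaptureExit (stmt-25597) on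
route-FinalStateConjecture-RootDecompTrappedBasinCells, reused BY SIGNATURE; text as born: [crux ·
child 𝓣₂^∞ of TrappedCaptureExit · thin · conjecturally EMPTY · IDEA-NEEDED; CLEARED by
decomp-fsc-crit-1-g0 2026-08-30T03:23:32Z (k = 3 chosen); writer glue/exactness
folder/n2bg3/Sketch.lean rc 0 / 0 sorry.] For every Σ and every admissible P_Σ-exceptional datum d
of the capture cell 𝓣₂ (not of dispersive type; every MGHD contains a closed trapped sphere in the
causal future of the data; every MGHD has complete future null infinity; d fails the weak C⁰
property P_w⁰) SOME of whose MGHDs ends with INFINITELY MANY black holes (¬ Finite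
(ConnectedComponents ↥𝓑⁺)), there are one end e and a tame (order 1 at e), immersed-at-0, injective
one-parameter family F of admissible data with F 0 = d all of whose members c ≠ 0 satisfy P_Σ. It
isolates … (full text as born on the home route) [difficulty: open-problem] (why it might fail:
Late-time tails refocusing through an already formed hole's strong field (caustics near photon
spheres) could keep forming ever smaller holes at ever later times on a tame-open set; no statement
either way is in print (arXiv:2210.13960 p.6).) [arXiv:0805.3880, arXiv:1409.6270,
Christodoulou1999, arXiv:0811.0354, arXiv:2210.13960, HawkingEllis1973]
#5 TrappedNakedExit (crux) — = the BORN N2b item stmt-FinalStateConjecture-25598 reused BY SIGNATURE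
(dedup-attach), text as born (abridged; full docstring in Theses/RootDecompTrappedBasinCells.lean):
PIECE 𝓣₁ — TrappedNakedExit [WEAKER·COUNTS·SPECIAL-TYPE — critic CLEARED 2026-08-30T02:40:09Z; weak
cosmic censorship AFTER trapping (cell empty in the spherical scalar-field model
doi:10.1088/0264-9381/22/11/019, expected codim ≥ 1 in vacuum); subsumes lens-5's TrappedNakedCell
(critic ruling); leaf IDEA-NEEDED; BARRIER-adjacent nakedSingularityInstability honoured as the
cure]. For every Σ and every admissible P_Σ-exceptional datum d, not of dispersive type, all of
whose MGHDs contain a closed trapped sphere to the future of the data, and SOME of whose MGHDs has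
incomplete future null infinity (weak cosmic censorship fails in the presence of a trapped sphere),
there are one end e and a […] [difficulty: open-problem] (why it might fail: a tame-open set of
admissible vacuum data whose MGHD traps a sphere AND forms a naked singularity outside the resulting
black hole (smooth-data analogue of the Hölder-class stability arXiv:2605.16235), or incompleteness
of 𝓘⁺ generated by the black-hole region itself on an open set.) [doi:10.1088/0264-9381/22/11/019,
arXiv:2402.10190, arXiv:2211.15742, arXiv:1912.08478, arXiv:2204.09891, arXiv:1407.4766,
arXiv:2605.16235, Christodoulou1999]
#6 TrappedExtremalExit (crux) — = the BORN N2b item stmt-FinalStateConjecture-25599 reused BY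
SIGNATURE (dedup-attach), text as born (abridged; full docstring in
Theses/RootDecompTrappedBasinCells.lean): PIECE 𝓣₃ — TrappedExtremalExit [WEAKER·COUNTS·SPECIAL-TYPE
— critic CLEARED 2026-08-30T02:40:09Z; generic THIRD LAW after trapping (transversal crossing of
|a_f|/M_f = 1 along a tame line) + pointwise C⁰→C² upgrade at sub-extremal members (content pinned
by stmt-FinalStateConjecture-17298 SubextremalUpgrade, cited by name); MODEL-ANALOGUE in print not a
rung (arXiv:2211.15742 Thm 1); INSTRUMENTABLE (remnant-spin census); BARRIER AretakisInstability
OUTSIDE (asks to leave the cell)]. For every Σ and every admissible P_Σ-exceptional datum d, not of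
dispersive type, all of whose MGHDs contain a closed trapped sphere to the future of the data, and
which SATISFIES the weak C⁰ property P_w⁰ (an […] [difficulty: open-problem] (why it might fail: the
set of trapped data with exactly extremal remnants could be tame-thick (accumulating on itself along
every tame line through a member), or every tame exit from it could pass through uncensored data;
vacuum extremal Kerr formation itself is open (arXiv:2402.10190 p.12).) [arXiv:2211.15742,
arXiv:2402.10190, arXiv:2304.08455, Aretakis2015, arXiv:1402.7034, Israel1986]
#7 ExtremalThresholdExit (crux) — = the BORN N2 item stmt-FinalStateConjecture-24765 reused BY
SIGNATURE (dedup-attach; declared kind SUPPORT on this route only to respect the 7-crux cap — it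
stays a crux on its home routes N2/N2b and is LOAD-BEARING in `closes` here), text as born: PIECE
𝓝∧P_w — ExtremalThresholdExit [WEAKER·thin — critic CLEARED 2026-08-30T01:39:13Z with retag: the
printed Kehle–Unger exit family (arXiv:2402.10190 Thm 1, Einstein–Maxwell–Vlasov) is a
MODEL-ANALOGUE, not a rung; leaf IDEA-NEEDED; BARRIER placement: AretakisInstability concerns
settling ON the threshold, this piece only asks to LEAVE it along a tame curve — outside; the bet is
transversality of B_crit]. For every Σ and every admissible P_Σ-exceptional datum d of threshold
type (not dispersive, not trapped) which satisfies the WEAK property P_w (an MGHD exists; every MGHD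
has complete 𝓘⁺ and a Kerr final state decomposition with all the Statement's clauses but only |aᵢ|
≤ Mᵢ — so d fails P_Σ only through an exactly extremal final hole), there are one end […]
[difficulty: open-problem] (why it might fail: the extremal critical set B_crit could be thick in
the tame topology (extremal thresholds accumulating on themselves along every tame line), or leaving
the threshold could land in naked data; vacuum extremal formation itself is open (arXiv:2402.10190
p.12).) [arXiv:2402.10190, arXiv:2211.15742, arXiv:2304.08455]
#8 DispersiveExit (crux) — = the BORN N2 item stmt-FinalStateConjecture-24766 reused BY SIGNATURE
(dedup-attach; declared kind SUPPORT on this route only to respect the 7-crux cap — it stays a crux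
on its home routes N2/N2b and is LOAD-BEARING in `closes` here), text as born: PIECE 𝓒 —
DispersiveExit [WEAKER·thin — critic CLEARED 2026-08-30T01:39:13Z; implied outright by the
registered pointwise item stmt-FinalStateConjecture-17320
`NoParkingWithoutHorizon.CompleteSpacetimesDisperse` (lens kernel
`dispersiveExit_of_completeSpacetimesDisperse`; cited by name, not re-typed); leaf IDEA-NEEDED;
attackable-now sub-rung: stationary-complete ⇒ flat (Lichnerowicz–Anderson port); rung stmt-10029
NoVacuumBreathers]. For every Σ and every admissible P_Σ-exceptional datum d of dispersive type (an
MGHD exists and every MGHD is future causally geodesically complete: no future null or timelike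
geodesic incompleteness, stated under the metric's Levi-Civita instance), there are one end e and a
tame immersed injective one-parameter family F of […] [difficulty: open-problem] (why it might fail:
a non-radiating vacuum breather or a complete development with curvature not decaying at i⁺ whose
tame neighbours are also exceptional (an open set) refutes it; no-breather results hold only near 𝓘
(arXiv:1504.04592) or for decaying solutions (arXiv:2108.13379).) [arXiv:2108.13379,
arXiv:1504.04592, doi:10.1007/PL00001021]
#9 NakedThresholdExit (support) — = the BORN N2 item stmt-FinalStateConjecture-24767 reused BY
SIGNATURE (dedup-attach; declared kind SUPPORT on this route only to respect the 7-crux cap — it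
stays a crux on its home routes N2/N2b and is LOAD-BEARING in `closes` here), text as born: PIECE
𝓝∧¬P_w — NakedThresholdExit [WEAKER·COUNTS — critic CLEARED 2026-08-30T01:39:13Z; = weak cosmic
censorship on the untrapped incomplete sector in Christodoulou's own codimension form (the all-cells
version is the registered hard core stmt-FinalStateConjecture-17269, cited; this is its cell
restriction with cure target P_Σ); leaf IDEA-NEEDED; BARRIER: nakedSingularityInstability is the
MODEL exit family (Christodoulou1999 Thm 4.1, 2-plane of exits) = the generic form, outside the
genericity-blind class; functional-framework dependence (Singh–Zheng arXiv:2605.16235: Hölder-stable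
naked singularities in the spherical scalar field) — the bet is that smooth tame data are on the
unstable side]. For every Σ and every admissible P_Σ-exceptional datum d of […] [difficulty:
open-problem] (why it might fail: a smooth-data analogue of the Singh–Zheng stability — a tame-open
set of admissible vacuum data forming naked singularities (RSR arXiv:1912.08478 exteriors are
fine-tuned, consistent so far).) [Christodoulou1999, arXiv:1912.08478, arXiv:2204.09891,
arXiv:2605.16235, arXiv:0811.0354]

TWO-LAYER PLAN. This route IS the third generation of N2's trapped basin promoted to a thin sibling
(D-0019: two item layers per route; 26645 is already a layer-2 child on N2b, so its cut lives here,
with 26645's siblings and N2b's other leaves carried by signature). Layer 2 here =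
{BoundedSingleExit, CascadeSingleExit} under SingleHoleCaptureExit (filed as the glued split right
after birth). Foreseen beneath BoundedSingleExit (gen 5, lens-5 NODE-g4.md §6 «ConeEntryCells»: Tail
= some outgoing-cone leaf enters every ε-basin of a subextremal Kerr in a DHRT/KS seed norm —
ATTACKABLE(porting) once facts D2 land; Brush = enters the theorem's own ε₁-basin but not Tail —
empty by theorem; Stray = never enters — the genuine large-data residual) — NOT filed and not
typable until definition D1 lands (PARK RULE, critic 03:28:43Z / 04:18:58Z).

KILL CRITERIA. All binders are S-implied in the kernel (restriction of the summit's cure to a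
sub-cell), so a refutation of any of them — a tame-open set of exceptional data inside one cell:
stable single-horizon hair or an eternally radiating censored single hole (BoundedSingleExit), a
stable eternal configuration with unboundedly many disjoint apparent horizons on late slices
(CascadeSingleExit) — refutes the summit AS TYPED and closes this route `refuted:<Decl>`; it feeds
the statement audit, not a pivot. Mooted piecewise: CascadeSingleExit closes for free when
stmt-13847 FiniteCensus is proved (certificate in hand); both children are mooted by a direct proof
of 26645 on N2b. Superseded if 26645 acquires a finer cleared cut on another axis that the critic
prefers (one active decomposition per node: this carve would then be retired here, not duplicated);
the shelved past-slice census cut (folder/n2c, OBJECTION 03:45:00Z O1–O4) is NOT such a candidate.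

NOT DECOMPOSED YET. BoundedSingleExit's interior (large-data one-body capture at C⁰ + rigidity
without analyticity + exclusion of eternal large-amplitude ringing) is famous-grade and deliberately
not decomposed: by caution c8 its next rung cannot be a transported Cauchy-window basin entry, and
the 𝓘⁺-transversal currency (D1) is not in the tree; the census rung `CaptureExitLE 0` (trapped but
never an outermost body) is conjecturally vacuous and NOT claimed (UNDECIDED, caution c4); constants
never enter binders.

CHEAPEST FALSIFIER. CascadeSingleExit: any printed or simulated vacuum datum with one final hole
whose future slices carry unboundedly many pairwise-disjoint apparent horizons (none known or
conjectured: horizons merge and counts go down, Hawking–Ellis §9.2; a cascade at bounded ADM mass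
needs unboundedly many formation events) — a lookup, unrun here (kit_allowed = false).
BoundedSingleExit: a printed tame-open family of single-horizon non-Kerr stationary vacuum exteriors
or of eternally ringing censored single holes (none; rigidity known under analyticity or near Kerr,
arXiv:0902.1173; nonlinear Kerr stability for |a| ≪ M, KlainermanSzeftel2023). The route itself dies
cheaply if the by-signature attach of any of its eight top-level items is refused (then fallback
(a): flat cone with the lens's 9-binder closes_tree).

NUMBERS. Print only: binary-merger remnants |a_f|/M_f ≲ 0.95 and 100 % merger-or-scatter outcomes in
the SXS catalogue (arXiv:1904.04831); instrument budgets C-g3-1 10–20 core-h, C-g3-2 10–30 core-h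
(lens-5 memo). No constant enters a binder.

DEFINITION REQUESTS. Relayed from lens-5 NODE-g4.md §5, ENDORSED by the critic 04:18:58Z (filed by
the writer as definition/cite work items after birth; none is a binder of this route): D1
(definition, Literature/Geometry/Lorentzian) CHARACTERISTIC SEED DATA INSIDE A DEVELOPMENT —
`ConeData 𝒟` (outgoing ∪ incoming null cones meeting in a sphere, C_out future-complete towards 𝓘⁺,
DHRT double-null seed quantities read off 𝒟.metric) with the seminorm `seedEnergy k` of
arXiv:2104.08222 (initial-data norm, p.100) relative to Kerr(M, a) reference values; variant D1′ =
the Klainerman–Szeftel initial-data LAYER with frame norms ℑ_k (arXiv:2104.11857); either gives an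
𝓘⁺-transversal smallness functional `coneDist 𝒟 (M, a) k`. D2 (facts, cite-tagged):
`dhrt_schwarzschild_codim3_characteristic` (arXiv:2104.08222 Thm I.3.1) and
`klainerman_szeftel_kerr_layer` (arXiv:2104.11857 Main Theorem) in native currency + a separate
porting item to the tree's P-currency. D3 (support lemma, Theorems-side): FUTURE-SLICE TRANSPORT —
for an MGHD 𝒟 of d and a Cauchy hypersurface Σ′ ⊂ J⁺(range 𝒟.embed) with induced data D′, J⁺(Σ′) in
𝒟 is the MGHD of D′, and P-type conclusions transfer from the sub-development to 𝒟.

Novelty: GEN-4 (2026-08-30T04:17Z, lens-5 g4 + critic 04:18:58Z + writer): the move = cut a born fate-side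
residual by BOUNDEDNESS of the outermost-MOTS body census on FUTURE slices, turning the census
conjecture (stmt-13847, so far only an ∀-data hypothesis in CriticalAncestry / HarmonicFluxCensus /
SuperenergyCensus) into a certified cell boundary; nearest in-tree = the shelved past-slice γ-cut
(folder/n2c, objected 03:45:00Z) and lens-4's MultiplicityJump (stmt-26250/26251, threshold cell
only). Searches (lens-5, 2026-08-30, labelled) as recorded for gen 3 below plus
[corpus:arxiv-0811.0354 p.22] [corpus:arxiv-0910.4957 p.4] [corpus:arxiv-2104.08222 p.3, p.100]
[corpus:arxiv-2104.11857 p.43, p.51] for the c8 finding; null for the move: no hits for a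
future-census cell decomposition of the exceptional set in corpus (fts+vec) and galaxy ("apparent
horizons unbounded number|final state conjecture census", --star all). Delta in one sentence: the
census enters the trapped branch exactly once, as a kernel-certified implication from a registered
item, and the remaining single-hole residual is parked with a typed reason (c8) for what its next
rung must look like.
GEN-3 (2026-08-30T03:4xZ, lens-5 + critic + writer): nearest in-tree = the parent N2b child 26645
(lens-2 g3 final-hole COUNT via connected components of the black-hole region — teleological) and
lens-4's MultiplicityJump (stmt-26250/26251, neighbours' final Kerr count d.N on the threshold cell,
undefined on 𝓣₂); census routes Cri  [refs: arxiv-0811.0354, arxiv-0910.4957, arxiv-2104.08222, arxiv-2104.11857, HawkingEllis1973, AnderssonMetzgerTrapped2009]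

Barriers (technique_class: population-split, hole-count, penrose-trichotomy): - technique_class: population-split, hole-count, penrose-trichotomy
- Literature.Barriers.FinalStateConjecture.nakedSingularityInstability: genericity-blind methods
excluded; NakedThresholdExit / TrappedNakedExit / all pieces are the GENERIC (tame-curve) forms —
outside the class; the barrier's own theorem (Christodoulou 1999 Thm 4.1) is the model exit family.
- Literature.Barriers.FinalStateConjecture.AretakisInstability: bites settling ON an extremal
horizon and every uniform-in-spin road inside TrappedCaptureExit; ExtremalThresholdExit and
TrappedExtremalExit only ask to LEAVE the extremal cell along a tame curve — outside (critic
placement 02:40:09Z); inside TrappedCaptureExit near-extremal capture roads it is declared, not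
evaded.
- Literature.Barriers.FinalStateConjecture.SlowlyRotatingKerrFrontier: printed near-Kerr basins are
NOT split off as a cell (a theorem-cell would be decorative); TrappedCaptureExit's closing as typed
needs the full range — inside the frontier's shadow for roads, acknowledged.
- Literature.Barriers.FinalStateConjecture.KerrSuperradiance: decay-estimate barrier for linear
roads inside TrappedCaptureExit; the binders are data-side exit statements — outside for the
statements, inside for every decay road (DRSR currents needed).
- Literature.Barriers.FinalStateConjecture.SbierskiTrappingObstruction: derivative loss at trapping;
no decay rate is typed in any item — outside for statements, inside for decay roads.
- Literature.Barriers.FinalStateConjec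

sub-problem: FinalStateConjecture · status: draft · opened planner-decomp-fsc-writer-1-g0-0 2026-08-30T04:22:02Z · rev 2 · ledger route-FinalStateConjecture-RootDecompHoleCountCells
GENERATED by the gate from the ledger (D-0016/17). Provers cite these decls: `theorem foo : Summit.FinalStateConjecture.FinalStateConjecture.Theses.RootDecompHoleCountCells.<Decl> := …` in Summits/FinalStateConjecture/FinalStateConjecture/Theorems/<Name>.lean.
-/

namespace Summit.FinalStateConjecture.FinalStateConjecture.Theses.RootDecompHoleCountCells

open scoped BigOperators Topology Manifold Classical MeasureTheory ProbabilityTheory Matrix InnerProductSpace ComplexConjugate ContinuousMap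
open Filter Set Function TopologicalSpace MeasureTheory

attribute [summit_statement] _root_.FinalStateConjecture

/-- item stmt-FinalStateConjecture-26645 · crux · rank 2 · SPLIT (gen 1) into BoundedSingleExit, CascadeSingleExit + glue SingleHoleCaptureExitGlue · direct attempts still welcome (low priority) · by planner
why it might fail: A tame-open set of trapped, censored admissible data forming ONE hole whose exterior never C⁰-settles to Kerr: smooth non-Kerr stationary hair with connected horizon (rigidity without analyticity is open), or a non-decaying high-frequency tail (Burnett-type), would refute it.
sources: arXiv:2606.28253, KlainermanSzeftel2023, GiorgiKlainermanSzeftel2022, DafermosHolzegelRodnianskiTaylor2021, arXiv:0902.1173, arXiv:1710.01722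
[crux · child 𝓣₂¹ of TrappedCaptureExit · NEW RESIDUAL · GENERIC-TYPE; CLEARED by
decomp-fsc-crit-1-g0 2026-08-30T03:23:32Z (k = 3 chosen); writer glue/exactness
folder/n2bg3/Sketch.lean rc 0 / 0 sorry.] For every Σ and every admissible P_Σ-exceptional datum d
of the capture cell 𝓣₂ (not of dispersive type; every MGHD contains a closed trapped sphere in the
causal future of the data; every MGHD has complete future null infinity; d fails the weak C⁰
property P_w⁰) ALL of whose MGHDs 𝒟 end with AT MOST ONE black hole — the future black-hole region
𝓑⁺(𝒟) = blackHoleRegion 𝒟 ∩ J⁺(range 𝒟.embed) (EventHorizon.lean vocabulary; = J⁺(ιΣ) minus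
exteriorOf 𝒟 (completeNullRayRegion 𝒟)) has at most one connected component (Subsingleton
(ConnectedComponents ↥𝓑⁺), i.e. 𝓑⁺ preconnected; standing instance [HasLeviCivita] bound innermost
as in CauchyDevelopment.lean) — there are one end e and a tame (order 1 at e), immersed-at-0,
injective one-parameter family F of admissible data with F 0 = d all of whose members c ≠ 0 satisfy
P_Σ. Content: the ONE-HOLE endgame at C⁰ (large-data capture of a single censored collapsed system,
rigidity of a connected-horizon stationary end state without analyticity, -/
@[route_item "route-FinalStateConjecture-RootDecompHoleCountCells", crux]
def SingleHoleCaptureExit : Prop :=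
  ∀ (X : Type) [TopologicalSpace X] [ChartedSpace Literature.Geometry.Lorentzian.E3 X] [IsManifold (𝓡 3) ((⊤ : ℕ∞) : WithTop ℕ∞) X] [T2Space X] [SecondCountableTopology X] [ConnectedSpace X], let P : Literature.Geometry.Lorentzian.InitialDataSet (𝓡 3) X → Prop := fun D ↦ (∃ 𝒟 : Literature.Geometry.Lorentzian.VacuumCauchyDevelopment D, 𝒟.IsMaximal) ∧ ∀ 𝒟 : Literature.Geometry.Lorentzian.VacuumCauchyDevelopment D, 𝒟.IsMaximal → Summit.FinalStateConjecture.HasCompleteNullInfinity 𝒟.toCauchyDevelopment ∧ ∃ (O : Set 𝒟.carrier) (d : Literature.Geometry.Lorentzian.FinalStateDecomposition 𝒟.toSpacetime O 2), (∀ i, Literature.Geometry.Lorentzian.Kerr.IsSubextremal (d.mass i) (d.spin i)) ∧ O = Summit.FinalStateConjecture.exteriorOf 𝒟.toCauchyDevelopment d.charted ∧ Summit.FinalStateConjecture.RaysStayInClosure 𝒟.toCauchyDevelopment O ∧ Summit.FinalStateConjecture.HasExhaustiveCharts d ∧ Summit.FinalStateConjecture.IsFutureOriented d; let Pw0 : Literature.Geometry.Lorentzian.InitialDataSet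 (𝓡 3) X → Prop := fun D ↦ (∃ 𝒟 : Literature.Geometry.Lorentzian.VacuumCauchyDevelopment D, 𝒟.IsMaximal) ∧ ∀ 𝒟 : Literature.Geometry.Lorentzian.VacuumCauchyDevelopment D, 𝒟.IsMaximal → Summit.FinalStateConjecture.HasCompleteNullInfinity 𝒟.toCauchyDevelopment ∧ ∃ (O : Set 𝒟.carrier) (d : Literature.Geometry.Lorentzian.FinalStateDecomposition 𝒟.toSpacetime O 0), O = Summit.FinalStateConjecture.exteriorOf 𝒟.toCauchyDevelopment d.charted ∧ Summit.FinalStateConjecture.RaysStayInClosure 𝒟.toCauchyDevelopment O ∧ Summit.FinalStateConjecture.HasExhaustiveCharts d ∧ Summit.FinalStateConjecture.IsFutureOriented d; let Disp : Literature.Geometry.Lorentzian.InitialDataSet (𝓡 3) X → Prop := fun D ↦ (∃ 𝒟 : Literature.Geometry.Lorentzian.VacuumCauchyDevelopment D, 𝒟.IsMaximal) ∧ ∀ 𝒟 : Literature.Geometry.Lorentzian.VacuumCauchyDevelopment D, 𝒟.IsMaximal → ∀ [𝒟.metric.HasLeviCivita], ¬ 𝒟.metric.IsFutureNullGeodesicallyIncomplete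 𝒟.timeOrientation ∧ ¬ 𝒟.metric.IsFutureTimelikeGeodesicallyIncomplete 𝒟.timeOrientation; let Trap : Literature.Geometry.Lorentzian.InitialDataSet (𝓡 3) X → Prop := fun D ↦ (∃ 𝒟 : Literature.Geometry.Lorentzian.VacuumCauchyDevelopment D, 𝒟.IsMaximal) ∧ ∀ 𝒟 : Literature.Geometry.Lorentzian.VacuumCauchyDevelopment D, 𝒟.IsMaximal → ∀ [𝒟.metric.HasLeviCivita], ∃ f : Metric.sphere (0 : Literature.Geometry.Lorentzian.E3) 1 → 𝒟.carrier, Set.range f ⊆ 𝒟.metric.causalFuture 𝒟.timeOrientation (Set.range 𝒟.embed) ∧ 𝒟.metric.IsTrappedSurface (𝓡 2) 𝒟.timeOrientation f; let Cens : Literature.Geometry.Lorentzian.InitialDataSet (𝓡 3) X → Prop := fun D ↦ ∀ 𝒟 : Literature.Geometry.Lorentzian.VacuumCauchyDevelopment D, 𝒟.IsMaximal → Summit.FinalStateConjecture.HasCompleteNullInfinity 𝒟.toCauchyDevelopment; let Single : Literature.Geometry.Lorentzian.InitialDataSet (𝓡 3) X → Prop := fun D ↦ ∀ 𝒟 : Literature.Geometry.Lorentzian.VacuumCauchyDevelopment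 D, 𝒟.IsMaximal → ∀ [𝒟.metric.HasLeviCivita], Subsingleton (ConnectedComponents ↥(Literature.Geometry.Lorentzian.DataEmbedding.blackHoleRegion 𝒟.toDataEmbedding ∩ 𝒟.metric.causalFuture 𝒟.timeOrientation (Set.range 𝒟.embed))); ∀ d ∈ Literature.Geometry.Lorentzian.admissibleVacuumData X, ¬ P d → ((¬ Disp d ∧ Trap d ∧ Cens d ∧ ¬ Pw0 d) ∧ Single d) → ∃ (e : Literature.Geometry.Lorentzian.AFEnd X) (F : EuclideanSpace ℝ (Fin 1) → Literature.Geometry.Lorentzian.InitialDataSet (𝓡 3) X), Literature.Geometry.Lorentzian.InitialDataSet.IsTameDataFamily e 1 F ∧ Literature.Geometry.Lorentzian.InitialDataSet.IsImmersedAtZero 1 F ∧ F 0 = d ∧ Injective F ∧ (∀ c, F c ∈ Literature.Geometry.Lorentzian.admissibleVacuumData X) ∧ ∀ c ≠ 0, P (F c)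

-- parent: SingleHoleCaptureExit · child (gen 1)
/--     item stmt-FinalStateConjecture-27603 · crux · rank 201 · open
    parent: SingleHoleCaptureExit · by planner
    why it might fail: It is 26645's residual renamed: a tame-open family of censored single-hole developments that never become C⁰-close to subextremal Kerr (eternal ringing / non-Kerr hair at finite a) refutes it and S as typed; KerrSuperradiance, SlowlyRotatingKerrFrontier bite every road.
    sources: arXiv:0805.3880, KlainermanSzeftel2023, GiorgiKlainermanSzeftel2022, DafermosHolzegelRodnianskiTaylor2021, arXiv:2606.28253, arXiv:0902.1173
[crux · NEW RESIDUAL · INTERNAL NODE · PARKED] lens-5 g4 «FutureCensusCarve» child 1 of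
SingleHoleCaptureExit (stmt-26645; critic option (A) of OBJECTION 03:45:00Z, CLEARED[split]
2026-08-30T04:18:58Z): the single-final-hole capture cell 𝓒 (admissible, not dispersive, every MGHD
traps, complete 𝓘⁺, weak C⁰-Kerr fails, at most one final hole) AND CenFinF d := for every MGHD
there is n such that every FUTURE Cauchy slice (range ι′ ⊆ J⁺(range 𝒟.embed); slice unbundled
cast-free as (X′, D′, ι′, ν′) with IsSmoothEmbedding / future unit normal / pullbackBilin /
secondFundamentalForm / IsCauchyHypersurface) carries no n+1 pairwise-disjoint outermost-MOTS bodies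
(census clause byte-identical to stmt-13847's) — admits a tame injective line of admissible data
through d whose other members satisfy P verbatim. Lets P/Pw0/Disp/Trap/Cens/Single byte-identical to
the born 26645; one new let CenFinF. = 26645 minus a conjecturally empty sliver: NO endgame
difficulty removed (large-data exterior Kerr stability at C⁰ + rigidity + no eternally radiating
censored single hole); PARK RULE: no further cut without an attackable norm-matched rung, which by
caution c8 (radiation memory of i⁰-weighted Cauchy -/
@[route_item "route-FinalStateConjecture-RootDecompHoleCountCells"]
def BoundedSingleExit : Prop :=
  ∀ (X : Type) [TopologicalSpace X] [ChartedSpace Literature.Geometry.Lorentzian.E3 X] [IsManifold (𝓡 3) ((⊤ : ℕ∞) : WithTop ℕ∞) X] [T2Space X] [SecondCountableTopology X] [ConnectedSpace X], let P : Literature.Geometry.Lorentzian.InitialDataSet (𝓡 3) X → Prop := fun D ↦ (∃ 𝒟 : Literature.Geometry.Lorentzian.VacuumCauchyDevelopment D, 𝒟.IsMaximal) ∧ ∀ 𝒟 : Literature.Geometry.Lorentzian.VacuumCauchyDevelopment D, 𝒟.IsMaximal → Summit.FinalStateConjecture.HasCompleteNullInfinity 𝒟.toCauchyDevelopment ∧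 ∃ (O : Set 𝒟.carrier) (d : Literature.Geometry.Lorentzian.FinalStateDecomposition 𝒟.toSpacetime O 2), (∀ i, Literature.Geometry.Lorentzian.Kerr.IsSubextremal (d.mass i) (d.spin i)) ∧ O = Summit.FinalStateConjecture.exteriorOf 𝒟.toCauchyDevelopment d.charted ∧ Summit.FinalStateConjecture.RaysStayInClosure 𝒟.toCauchyDevelopment O ∧ Summit.FinalStateConjecture.HasExhaustiveCharts d ∧ Summit.FinalStateConjecture.IsFutureOriented d; let Pw0 : Literature.Geometry.Lorentzian.InitialDataSet (𝓡 3) X → Prop := fun D ↦ (∃ 𝒟 : Literature.Geometry.Lorentzian.VacuumCauchyDevelopment D, 𝒟.IsMaximal) ∧ ∀ 𝒟 : Literature.Geometry.Lorentzian.VacuumCauchyDevelopment D, 𝒟.IsMaximal → Summit.FinalStateConjecture.HasCompleteNullInfinity 𝒟.toCauchyDevelopment ∧ ∃ (O : Set 𝒟.carrier) (d : Literature.Geometry.Lorentzian.FinalStateDecomposition 𝒟.toSpacetime O 0), O = Summit.FinalStateConjecture.exteriorOf 𝒟.toCauchyDevelopment d.charted ∧ Summit.FinalStateConjecture.RaysStayInClosure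 𝒟.toCauchyDevelopment O ∧ Summit.FinalStateConjecture.HasExhaustiveCharts d ∧ Summit.FinalStateConjecture.IsFutureOriented d; let Disp : Literature.Geometry.Lorentzian.InitialDataSet (𝓡 3) X → Prop := fun D ↦ (∃ 𝒟 : Literature.Geometry.Lorentzian.VacuumCauchyDevelopment D, 𝒟.IsMaximal) ∧ ∀ 𝒟 : Literature.Geometry.Lorentzian.VacuumCauchyDevelopment D, 𝒟.IsMaximal → ∀ [𝒟.metric.HasLeviCivita], ¬ 𝒟.metric.IsFutureNullGeodesicallyIncomplete 𝒟.timeOrientation ∧ ¬ 𝒟.metric.IsFutureTimelikeGeodesicallyIncomplete 𝒟.timeOrientation; let Trap : Literature.Geometry.Lorentzian.InitialDataSet (𝓡 3) X → Prop := fun D ↦ (∃ 𝒟 : Literature.Geometry.Lorentzian.VacuumCauchyDevelopment D, 𝒟.IsMaximal) ∧ ∀ 𝒟 : Literature.Geometry.Lorentzian.VacuumCauchyDevelopment D, 𝒟.IsMaximal → ∀ [𝒟.metric.HasLeviCivita], ∃ f : Metric.sphere (0 : Literature.Geometry.Lorentzian.E3) 1 → 𝒟.carrier, Set.range f ⊆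 𝒟.metric.causalFuture 𝒟.timeOrientation (Set.range 𝒟.embed) ∧ 𝒟.metric.IsTrappedSurface (𝓡 2) 𝒟.timeOrientation f; let Cens : Literature.Geometry.Lorentzian.InitialDataSet (𝓡 3) X → Prop := fun D ↦ ∀ 𝒟 : Literature.Geometry.Lorentzian.VacuumCauchyDevelopment D, 𝒟.IsMaximal → Summit.FinalStateConjecture.HasCompleteNullInfinity 𝒟.toCauchyDevelopment; let Single : Literature.Geometry.Lorentzian.InitialDataSet (𝓡 3) X → Prop := fun D ↦ ∀ 𝒟 : Literature.Geometry.Lorentzian.VacuumCauchyDevelopment D, 𝒟.IsMaximal → ∀ [𝒟.metric.HasLeviCivita], Subsingleton (ConnectedComponents ↥(Literature.Geometry.Lorentzian.DataEmbedding.blackHoleRegion 𝒟.toDataEmbedding ∩ 𝒟.metric.causalFuture 𝒟.timeOrientation (Set.range 𝒟.embed))); let CenFinF : Literature.Geometry.Lorentzian.InitialDataSet (𝓡 3) X → Prop := fun D ↦ ∀ 𝒟 : Literature.Geometry.Lorentzian.VacuumCauchyDevelopment D, 𝒟.IsMaximal → ∃ n : ℕ, ∀ (X' : Type) [TopologicalSpace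 X'] [ChartedSpace Literature.Geometry.Lorentzian.E3 X'] [IsManifold (𝓡 3) ((⊤ : ℕ∞) : WithTop ℕ∞) X'] [ConnectedSpace X'] (D' : Literature.Geometry.Lorentzian.InitialDataSet (𝓡 3) X') (ι' : X' → 𝒟.carrier) (ν' : Literature.Geometry.Lorentzian.NormalField (𝓡 4) ι'), Manifold.IsSmoothEmbedding (𝓡 3) (𝓡 4) ((⊤ : ℕ∞) : WithTop ℕ∞) ι' → 𝒟.metric.IsFutureUnitNormal (𝓡 3) 𝒟.timeOrientation ι' ν' → (∀ y : X', Literature.Geometry.Lorentzian.pullbackBilin (I := 𝓡 4) (I' := 𝓡 3) ι' 𝒟.metric.val y = D'.h.inner y) → (∀ [𝒟.metric.toPseudoRiemannianMetric.HasLeviCivita] (y : X'), 𝒟.metric.toPseudoRiemannianMetric.secondFundamentalForm (𝓡 3) ι' ν' y = D'.kBilin y) → 𝒟.metric.IsCauchyHypersurface 𝒟.timeOrientation (Set.range ι') → Set.range ι' ⊆ 𝒟.metric.causalFuture 𝒟.timeOrientation (Set.range 𝒟.embed) → ∀ S : Fin (n + 1) → Literature.Geometry.Lorentzian.OutermostMOTS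 (𝓡 3) D'.h D'.k, (∀ j, ConnectedSpace (S j).surf) → (∀ j, IsCompact (((S j).exterior : Set X'))ᶜ ∧ (interior (((S j).exterior : Set X'))ᶜ).Nonempty) → ∃ j j', j ≠ j' ∧ ((((S j).exterior : Set X'))ᶜ ∩ (((S j').exterior : Set X'))ᶜ).Nonempty; ∀ d ∈ Literature.Geometry.Lorentzian.admissibleVacuumData X, ¬ P d → (((¬ Disp d ∧ Trap d ∧ Cens d ∧ ¬ Pw0 d) ∧ Single d) ∧ CenFinF d) → ∃ (e : Literature.Geometry.Lorentzian.AFEnd X) (F : EuclideanSpace ℝ (Fin 1) → Literature.Geometry.Lorentzian.InitialDataSet (𝓡 3) X), Literature.Geometry.Lorentzian.InitialDataSet.IsTameDataFamily e 1 F ∧ Literature.Geometry.Lorentzian.InitialDataSet.IsImmersedAtZero 1 F ∧ F 0 = d ∧ Injective F ∧ (∀ c, F c ∈ Literature.Geometry.Lorentzian.admissibleVacuumData X) ∧ ∀ c ≠ 0, P (F c)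

-- parent: SingleHoleCaptureExit · child (gen 1)
/--     item stmt-FinalStateConjecture-27604 · support · rank 202 · open
    parent: SingleHoleCaptureExit · by planner
    why it might fail: Vacuous iff 13847 FiniteCensus holds on the cell; a single-final-hole development whose future slices carry unboundedly many disjoint shrinking outermost-MOTS bodies (not excluded by Penrose-type area/mass heuristics) would make it contentful and as hard as 26645 there.
    sources: HawkingEllis1973, AnderssonMetzgerTrapped2009, arXiv:0805.3880, arXiv:1407.4766, doi:10.1103/PhysRevLett.14.57
[support · THIN BRIDGE ⟸ stmt-13847 · conjecturally VACUOUS · dominated] lens-5 g4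
«FutureCensusCarve» child 2 of SingleHoleCaptureExit (stmt-26645; CLEARED[split]
2026-08-30T04:18:58Z): the cell 𝓒 AND ¬CenFinF d (one final hole, yet some MGHD carries future
Cauchy slices with arbitrarily many pairwise-disjoint outermost-MOTS bodies) — admits a tame
injective exit line with P verbatim. Registered kill path: stmt-13847 CriticalAncestry.FiniteCensus
⟹ this item, kernel-certified by the lens as cascadeSingleExit_of_finiteCensus : FiniteCensusR →
CascadeSingleExit (an unbundled future slice IS a CauchyDevelopment D′ with rfl-same spacetime;
FiniteCensusR = character-identical copy of 13847 because importing Theses.CriticalAncestry answers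
rc 75 unbuilt) — modus ponens, no analysis; closes the day 13847 closes. Kind support = per-route
bookkeeping for a dominated bridge (it never drives staffing). c5 harmless here (13847 carries the
same clause). -/
@[route_item "route-FinalStateConjecture-RootDecompHoleCountCells"]
def CascadeSingleExit : Prop :=
  ∀ (X : Type) [TopologicalSpace X] [ChartedSpace Literature.Geometry.Lorentzian.E3 X] [IsManifold (𝓡 3) ((⊤ : ℕ∞) : WithTop ℕ∞) X] [T2Space X] [SecondCountableTopology X] [ConnectedSpace X], let P : Literature.Geometry.Lorentzian.InitialDataSet (𝓡 3) X → Prop := fun D ↦ (∃ 𝒟 : Literature.Geometry.Lorentzian.VacuumCauchyDevelopment D, 𝒟.IsMaximal) ∧ ∀ 𝒟 : Literature.Geometry.Lorentzian.VacuumCauchyDevelopment D, 𝒟.IsMaximal → Summit.FinalStateConjecture.HasCompleteNullInfinity 𝒟.toCauchyDevelopment ∧ ∃ (O : Set 𝒟.carrier) (d : Literature.Geometry.Lorentzian.FinalStateDecomposition 𝒟.toSpacetime O 2), (∀ i, Literature.Geometry.Lorentzian.Kerr.IsSubextremal (d.mass i) (d.spin i)) ∧ O = Summit.FinalStateConjecture.exteriorOf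 𝒟.toCauchyDevelopment d.charted ∧ Summit.FinalStateConjecture.RaysStayInClosure 𝒟.toCauchyDevelopment O ∧ Summit.FinalStateConjecture.HasExhaustiveCharts d ∧ Summit.FinalStateConjecture.IsFutureOriented d; let Pw0 : Literature.Geometry.Lorentzian.InitialDataSet (𝓡 3) X → Prop := fun D ↦ (∃ 𝒟 : Literature.Geometry.Lorentzian.VacuumCauchyDevelopment D, 𝒟.IsMaximal) ∧ ∀ 𝒟 : Literature.Geometry.Lorentzian.VacuumCauchyDevelopment D, 𝒟.IsMaximal → Summit.FinalStateConjecture.HasCompleteNullInfinity 𝒟.toCauchyDevelopment ∧ ∃ (O : Set 𝒟.carrier) (d : Literature.Geometry.Lorentzian.FinalStateDecomposition 𝒟.toSpacetime O 0), O = Summit.FinalStateConjecture.exteriorOf 𝒟.toCauchyDevelopment d.charted ∧ Summit.FinalStateConjecture.RaysStayInClosure 𝒟.toCauchyDevelopment O ∧ Summit.FinalStateConjecture.HasExhaustiveCharts d ∧ Summit.FinalStateConjecture.IsFutureOriented d; let Disp : Literature.Geometry.Lorentzian.InitialDataSet (𝓡 3) X → Prop := fun D ↦ (∃ 𝒟 :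 Literature.Geometry.Lorentzian.VacuumCauchyDevelopment D, 𝒟.IsMaximal) ∧ ∀ 𝒟 : Literature.Geometry.Lorentzian.VacuumCauchyDevelopment D, 𝒟.IsMaximal → ∀ [𝒟.metric.HasLeviCivita], ¬ 𝒟.metric.IsFutureNullGeodesicallyIncomplete 𝒟.timeOrientation ∧ ¬ 𝒟.metric.IsFutureTimelikeGeodesicallyIncomplete 𝒟.timeOrientation; let Trap : Literature.Geometry.Lorentzian.InitialDataSet (𝓡 3) X → Prop := fun D ↦ (∃ 𝒟 : Literature.Geometry.Lorentzian.VacuumCauchyDevelopment D, 𝒟.IsMaximal) ∧ ∀ 𝒟 : Literature.Geometry.Lorentzian.VacuumCauchyDevelopment D, 𝒟.IsMaximal → ∀ [𝒟.metric.HasLeviCivita], ∃ f : Metric.sphere (0 : Literature.Geometry.Lorentzian.E3) 1 → 𝒟.carrier, Set.range f ⊆ 𝒟.metric.causalFuture 𝒟.timeOrientation (Set.range 𝒟.embed) ∧ 𝒟.metric.IsTrappedSurface (𝓡 2) 𝒟.timeOrientation f; let Cens : Literature.Geometry.Lorentzian.InitialDataSet (𝓡 3) X → Prop := fun D ↦ ∀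 𝒟 : Literature.Geometry.Lorentzian.VacuumCauchyDevelopment D, 𝒟.IsMaximal → Summit.FinalStateConjecture.HasCompleteNullInfinity 𝒟.toCauchyDevelopment; let Single : Literature.Geometry.Lorentzian.InitialDataSet (𝓡 3) X → Prop := fun D ↦ ∀ 𝒟 : Literature.Geometry.Lorentzian.VacuumCauchyDevelopment D, 𝒟.IsMaximal → ∀ [𝒟.metric.HasLeviCivita], Subsingleton (ConnectedComponents ↥(Literature.Geometry.Lorentzian.DataEmbedding.blackHoleRegion 𝒟.toDataEmbedding ∩ 𝒟.metric.causalFuture 𝒟.timeOrientation (Set.range 𝒟.embed))); let CenFinF : Literature.Geometry.Lorentzian.InitialDataSet (𝓡 3) X → Prop := fun D ↦ ∀ 𝒟 : Literature.Geometry.Lorentzian.VacuumCauchyDevelopment D, 𝒟.IsMaximal → ∃ n : ℕ, ∀ (X' : Type) [TopologicalSpace X'] [ChartedSpace Literature.Geometry.Lorentzian.E3 X'] [IsManifold (𝓡 3) ((⊤ : ℕ∞) : WithTop ℕ∞) X'] [ConnectedSpace X'] (D' : Literature.Geometry.Lorentzian.InitialDataSet (𝓡 3) X') (ι' : X' → 𝒟.carrier)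 (ν' : Literature.Geometry.Lorentzian.NormalField (𝓡 4) ι'), Manifold.IsSmoothEmbedding (𝓡 3) (𝓡 4) ((⊤ : ℕ∞) : WithTop ℕ∞) ι' → 𝒟.metric.IsFutureUnitNormal (𝓡 3) 𝒟.timeOrientation ι' ν' → (∀ y : X', Literature.Geometry.Lorentzian.pullbackBilin (I := 𝓡 4) (I' := 𝓡 3) ι' 𝒟.metric.val y = D'.h.inner y) → (∀ [𝒟.metric.toPseudoRiemannianMetric.HasLeviCivita] (y : X'), 𝒟.metric.toPseudoRiemannianMetric.secondFundamentalForm (𝓡 3) ι' ν' y = D'.kBilin y) → 𝒟.metric.IsCauchyHypersurface 𝒟.timeOrientation (Set.range ι') → Set.range ι' ⊆ 𝒟.metric.causalFuture 𝒟.timeOrientation (Set.range 𝒟.embed) → ∀ S : Fin (n + 1) → Literature.Geometry.Lorentzian.OutermostMOTS (𝓡 3) D'.h D'.k, (∀ j, ConnectedSpace (S j).surf) → (∀ j, IsCompact (((S j).exterior : Set X'))ᶜ ∧ (interior (((S j).exterior : Set X'))ᶜ).Nonempty) → ∃ j j', j ≠ j' ∧ ((((S j).exterior : Set X'))ᶜ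 ∩ (((S j').exterior : Set X'))ᶜ).Nonempty; ∀ d ∈ Literature.Geometry.Lorentzian.admissibleVacuumData X, ¬ P d → (((¬ Disp d ∧ Trap d ∧ Cens d ∧ ¬ Pw0 d) ∧ Single d) ∧ ¬ CenFinF d) → ∃ (e : Literature.Geometry.Lorentzian.AFEnd X) (F : EuclideanSpace ℝ (Fin 1) → Literature.Geometry.Lorentzian.InitialDataSet (𝓡 3) X), Literature.Geometry.Lorentzian.InitialDataSet.IsTameDataFamily e 1 F ∧ Literature.Geometry.Lorentzian.InitialDataSet.IsImmersedAtZero 1 F ∧ F 0 = d ∧ Injective F ∧ (∀ c, F c ∈ Literature.Geometry.Lorentzian.admissibleVacuumData X) ∧ ∀ c ≠ 0, P (F c)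

-- parent: SingleHoleCaptureExit · glue (gen 1)
/--     item stmt-FinalStateConjecture-27605 · support · rank 203 · open
    parent: SingleHoleCaptureExit · GLUE: children ⟹ parent · by planner
BoundedSingleExit → CascadeSingleExit → SingleHoleCaptureExit -/
@[route_item "route-FinalStateConjecture-RootDecompHoleCountCells"]
def SingleHoleCaptureExitGlue : Prop :=
  BoundedSingleExit → CascadeSingleExit → SingleHoleCaptureExit

/-- item stmt-FinalStateConjecture-26646 · crux · rank 3 · SPLIT (gen 1) into RegularEquilibriumExit, IrregularEquilibriumExit, DynamicalMultiHoleExit + glue MultiHoleCaptureExitGlue · direct attempts still welcome (low priority) · by planner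
why it might fail: A tame-open set of admissible data whose MGHD keeps two holes on an eternal quasi-periodic censored orbit (a vacuum 'floating' binary), or n ≥ 3 co-axial multi-Kerr(–NUT) equilibria that exist AND are attained from an open set, would refute it; n ≥ 3 non-existence is open (CCH12 p.14).
sources: doi:10.1007/BF00770326, arXiv:0905.4179, arXiv:1103.5248, arXiv:1105.5830, arXiv:1111.1448, arXiv:0811.1727
[crux · child 𝓣₂² of TrappedCaptureExit · SPECIAL-TYPE (configurational) · INSTRUMENTABLE; CLEARED
by decomp-fsc-crit-1-g0 2026-08-30T03:23:32Z (k = 3 chosen); writer glue/exactness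
folder/n2bg3/Sketch.lean rc 0 / 0 sorry.] For every Σ and every admissible P_Σ-exceptional datum d
of the capture cell 𝓣₂ (not of dispersive type; every MGHD contains a closed trapped sphere in the
causal future of the data; every MGHD has complete future null infinity; d fails the weak C⁰
property P_w⁰) SOME of whose MGHDs ends with AT LEAST TWO black holes (𝓑⁺ not preconnected) and ALL
of whose MGHDs end with FINITELY MANY (Finite (ConnectedComponents ↥𝓑⁺)), there are one end e and a
tame (order 1 at e), immersed-at-0, injective one-parameter family F of admissible data with F 0 = d
all of whose members c ≠ 0 satisfy P_Σ. Content = the generic MANY-BODY sector of the capture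
problem: (i) no eternal non-merging bound binary with censored exterior (radiative dissipation),
(ii) no stationary n-horizon vacuum equilibrium to park at (static: Bunting–Masood-ul-Alam 1987,
Beig–Gibbons–Schoen 2009; n = 2 stationary: Neugebauer–Hennig + Chruściel et al., CCH12 Thm 3.6; n ≥
3 widely open), (iii) capture of each -/
@[route_item "route-FinalStateConjecture-RootDecompHoleCountCells", crux]
def MultiHoleCaptureExit : Prop :=
  ∀ (X : Type) [TopologicalSpace X] [ChartedSpace Literature.Geometry.Lorentzian.E3 X] [IsManifold (𝓡 3) ((⊤ : ℕ∞) : WithTop ℕ∞) X] [T2Space X] [SecondCountableTopology X] [ConnectedSpace X], let P : Literature.Geometry.Lorentzian.InitialDataSet (𝓡 3) X → Prop := fun D ↦ (∃ 𝒟 : Literature.Geometry.Lorentzian.VacuumCauchyDevelopment D, 𝒟.IsMaximal) ∧ ∀ 𝒟 : Literature.Geometry.Lorentzian.VacuumCauchyDevelopment D, 𝒟.IsMaximal → Summit.FinalStateConjecture.HasCompleteNullInfinity 𝒟.toCauchyDevelopment ∧ ∃ (O : Set 𝒟.carrier) (d : Literature.Geometry.Lorentzian.FinalStateDecomposition 𝒟.toSpacetime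 O 2), (∀ i, Literature.Geometry.Lorentzian.Kerr.IsSubextremal (d.mass i) (d.spin i)) ∧ O = Summit.FinalStateConjecture.exteriorOf 𝒟.toCauchyDevelopment d.charted ∧ Summit.FinalStateConjecture.RaysStayInClosure 𝒟.toCauchyDevelopment O ∧ Summit.FinalStateConjecture.HasExhaustiveCharts d ∧ Summit.FinalStateConjecture.IsFutureOriented d; let Pw0 : Literature.Geometry.Lorentzian.InitialDataSet (𝓡 3) X → Prop := fun D ↦ (∃ 𝒟 : Literature.Geometry.Lorentzian.VacuumCauchyDevelopment D, 𝒟.IsMaximal) ∧ ∀ 𝒟 : Literature.Geometry.Lorentzian.VacuumCauchyDevelopment D, 𝒟.IsMaximal → Summit.FinalStateConjecture.HasCompleteNullInfinity 𝒟.toCauchyDevelopment ∧ ∃ (O : Set 𝒟.carrier) (d : Literature.Geometry.Lorentzian.FinalStateDecomposition 𝒟.toSpacetime O 0), O = Summit.FinalStateConjecture.exteriorOf 𝒟.toCauchyDevelopment d.charted ∧ Summit.FinalStateConjecture.RaysStayInClosure 𝒟.toCauchyDevelopment O ∧ Summit.FinalStateConjecture.HasExhaustiveCharts d ∧ Summit.FinalStateConjecture.IsFutureOriented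 d; let Disp : Literature.Geometry.Lorentzian.InitialDataSet (𝓡 3) X → Prop := fun D ↦ (∃ 𝒟 : Literature.Geometry.Lorentzian.VacuumCauchyDevelopment D, 𝒟.IsMaximal) ∧ ∀ 𝒟 : Literature.Geometry.Lorentzian.VacuumCauchyDevelopment D, 𝒟.IsMaximal → ∀ [𝒟.metric.HasLeviCivita], ¬ 𝒟.metric.IsFutureNullGeodesicallyIncomplete 𝒟.timeOrientation ∧ ¬ 𝒟.metric.IsFutureTimelikeGeodesicallyIncomplete 𝒟.timeOrientation; let Trap : Literature.Geometry.Lorentzian.InitialDataSet (𝓡 3) X → Prop := fun D ↦ (∃ 𝒟 : Literature.Geometry.Lorentzian.VacuumCauchyDevelopment D, 𝒟.IsMaximal) ∧ ∀ 𝒟 : Literature.Geometry.Lorentzian.VacuumCauchyDevelopment D, 𝒟.IsMaximal → ∀ [𝒟.metric.HasLeviCivita], ∃ f : Metric.sphere (0 : Literature.Geometry.Lorentzian.E3) 1 → 𝒟.carrier, Set.range f ⊆ 𝒟.metric.causalFuture 𝒟.timeOrientation (Set.range 𝒟.embed) ∧ 𝒟.metric.IsTrappedSurface (𝓡 2) 𝒟.timeOrientation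 f; let Cens : Literature.Geometry.Lorentzian.InitialDataSet (𝓡 3) X → Prop := fun D ↦ ∀ 𝒟 : Literature.Geometry.Lorentzian.VacuumCauchyDevelopment D, 𝒟.IsMaximal → Summit.FinalStateConjecture.HasCompleteNullInfinity 𝒟.toCauchyDevelopment; let Single : Literature.Geometry.Lorentzian.InitialDataSet (𝓡 3) X → Prop := fun D ↦ ∀ 𝒟 : Literature.Geometry.Lorentzian.VacuumCauchyDevelopment D, 𝒟.IsMaximal → ∀ [𝒟.metric.HasLeviCivita], Subsingleton (ConnectedComponents ↥(Literature.Geometry.Lorentzian.DataEmbedding.blackHoleRegion 𝒟.toDataEmbedding ∩ 𝒟.metric.causalFuture 𝒟.timeOrientation (Set.range 𝒟.embed))); let FinMany : Literature.Geometry.Lorentzian.InitialDataSet (𝓡 3) X → Prop := fun D ↦ ∀ 𝒟 : Literature.Geometry.Lorentzian.VacuumCauchyDevelopment D, 𝒟.IsMaximal → ∀ [𝒟.metric.HasLeviCivita], Finite (ConnectedComponents ↥(Literature.Geometry.Lorentzian.DataEmbedding.blackHoleRegion 𝒟.toDataEmbedding ∩ 𝒟.metric.causalFuture 𝒟.timeOrientation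 (Set.range 𝒟.embed))); ∀ d ∈ Literature.Geometry.Lorentzian.admissibleVacuumData X, ¬ P d → ((¬ Disp d ∧ Trap d ∧ Cens d ∧ ¬ Pw0 d) ∧ ¬ Single d ∧ FinMany d) → ∃ (e : Literature.Geometry.Lorentzian.AFEnd X) (F : EuclideanSpace ℝ (Fin 1) → Literature.Geometry.Lorentzian.InitialDataSet (𝓡 3) X), Literature.Geometry.Lorentzian.InitialDataSet.IsTameDataFamily e 1 F ∧ Literature.Geometry.Lorentzian.InitialDataSet.IsImmersedAtZero 1 F ∧ F 0 = d ∧ Injective F ∧ (∀ c, F c ∈ Literature.Geometry.Lorentzian.admissibleVacuumData X) ∧ ∀ c ≠ 0, P (F c)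

-- parent: MultiHoleCaptureExit · child (gen 1)
/--     item stmt-FinalStateConjecture-28686 · crux · rank 301 · open
    parent: MultiHoleCaptureExit · by planner
    why it might fail: Conjecturally VACUOUS (no regular stationary vacuum multi-hole equilibrium: static BMuA87 vendored; n=2 I⁺-regular CCH12 Thm 3.6/NH09; n≥3 'widely open' CCH12 p.14), EMPTY under stmt-18557 by kernel; fails only if an n≥3 regular equilibrium exists and is P_Σ-exceptional with a fat neighbourhood.
    sources: stmt-FinalStateConjecture-18557, arXiv:1205.6112, arXiv:0905.4179, doi:10.1007/BF00770326, arXiv:0806.0016, Heusler1996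
[crux · gen-2 cut 1/3 of MultiHoleCaptureExit (stmt-FinalStateConjecture-26646), lens-2 g5 node
«EquilibriumCarve» = exact split by EXTERIOR STATIONARITY (special = equilibrium exterior, generic =
dynamical) · guard ∧ Equi d · THIN · WEAKER (S-implied: kernel cells_of_fsc) · SPECIAL-TYPE (exact
isometry, global Killing, CCH-regular) · conjecturally VACUOUS · EMPTY BY stmt-18557 (kernel bridge
regularEquilibriumExit_of_noMultiHorizonEquilibrium : HorizonTypeCascade.NoMultiHorizonEquilibrium →
RegularEquilibriumExit, NO other hypothesis — vacuum = the MGHD's own isRicciFlat, Levi-Civita = the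
∃-bound witness); provers attack 18557, not this item · DEDUP BY NAME (cites 18557, registered crux
r4 [open-problem] on DORMANT route HorizonTypeCascade; NO separate provers) · closes the day 18557
closes · does NOT count] For every Σ and every admissible P_Σ-exceptional datum d of the multi-hole
cell of 26646 (not of dispersive type; every MGHD traps; every MGHD has complete future null
infinity; d fails the weak C⁰ property P_w⁰; SOME MGHD ends with at least two black holes; ALL MGHDs
end with finitely many) one of whose MGHDs is a REGULAR STATIONARY MULTI-HORIZON EQUILIBRIUM (Equi
d), there -/
@[route_item "route-FinalStateConjecture-RootDecompHoleCountCells"]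
def RegularEquilibriumExit : Prop :=
  ∀ (X : Type) [TopologicalSpace X] [ChartedSpace Literature.Geometry.Lorentzian.E3 X] [IsManifold (𝓡 3) ((⊤ : ℕ∞) : WithTop ℕ∞) X] [T2Space X] [SecondCountableTopology X] [ConnectedSpace X], let P : Literature.Geometry.Lorentzian.InitialDataSet (𝓡 3) X → Prop := fun D ↦ (∃ 𝒟 : Literature.Geometry.Lorentzian.VacuumCauchyDevelopment D, 𝒟.IsMaximal) ∧ ∀ 𝒟 : Literature.Geometry.Lorentzian.VacuumCauchyDevelopment D, 𝒟.IsMaximal → Summit.FinalStateConjecture.HasCompleteNullInfinity 𝒟.toCauchyDevelopment ∧ ∃ (O : Set 𝒟.carrier) (d : Literature.Geometry.Lorentzian.FinalStateDecomposition 𝒟.toSpacetime O 2), (∀ i, Literature.Geometry.Lorentzian.Kerr.IsSubextremal (d.mass i) (d.spin i)) ∧ O = Summit.FinalStateConjecture.exteriorOf 𝒟.toCauchyDevelopment d.charted ∧ Summit.FinalStateConjecture.RaysStayInClosure 𝒟.toCauchyDevelopment O ∧ Summit.FinalStateConjecture.HasExhaustiveCharts d ∧ Summit.FinalStateConjecture.IsFutureOriented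 d; let Pw0 : Literature.Geometry.Lorentzian.InitialDataSet (𝓡 3) X → Prop := fun D ↦ (∃ 𝒟 : Literature.Geometry.Lorentzian.VacuumCauchyDevelopment D, 𝒟.IsMaximal) ∧ ∀ 𝒟 : Literature.Geometry.Lorentzian.VacuumCauchyDevelopment D, 𝒟.IsMaximal → Summit.FinalStateConjecture.HasCompleteNullInfinity 𝒟.toCauchyDevelopment ∧ ∃ (O : Set 𝒟.carrier) (d : Literature.Geometry.Lorentzian.FinalStateDecomposition 𝒟.toSpacetime O 0), O = Summit.FinalStateConjecture.exteriorOf 𝒟.toCauchyDevelopment d.charted ∧ Summit.FinalStateConjecture.RaysStayInClosure 𝒟.toCauchyDevelopment O ∧ Summit.FinalStateConjecture.HasExhaustiveCharts d ∧ Summit.FinalStateConjecture.IsFutureOriented d; let Disp : Literature.Geometry.Lorentzian.InitialDataSet (𝓡 3) X → Prop := fun D ↦ (∃ 𝒟 : Literature.Geometry.Lorentzian.VacuumCauchyDevelopment D, 𝒟.IsMaximal) ∧ ∀ 𝒟 : Literature.Geometry.Lorentzian.VacuumCauchyDevelopment D, 𝒟.IsMaximal → ∀ [𝒟.metric.HasLeviCivita],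 ¬ 𝒟.metric.IsFutureNullGeodesicallyIncomplete 𝒟.timeOrientation ∧ ¬ 𝒟.metric.IsFutureTimelikeGeodesicallyIncomplete 𝒟.timeOrientation; let Trap : Literature.Geometry.Lorentzian.InitialDataSet (𝓡 3) X → Prop := fun D ↦ (∃ 𝒟 : Literature.Geometry.Lorentzian.VacuumCauchyDevelopment D, 𝒟.IsMaximal) ∧ ∀ 𝒟 : Literature.Geometry.Lorentzian.VacuumCauchyDevelopment D, 𝒟.IsMaximal → ∀ [𝒟.metric.HasLeviCivita], ∃ f : Metric.sphere (0 : Literature.Geometry.Lorentzian.E3) 1 → 𝒟.carrier, Set.range f ⊆ 𝒟.metric.causalFuture 𝒟.timeOrientation (Set.range 𝒟.embed) ∧ 𝒟.metric.IsTrappedSurface (𝓡 2) 𝒟.timeOrientation f; let Cens : Literature.Geometry.Lorentzian.InitialDataSet (𝓡 3) X → Prop := fun D ↦ ∀ 𝒟 : Literature.Geometry.Lorentzian.VacuumCauchyDevelopment D, 𝒟.IsMaximal → Summit.FinalStateConjecture.HasCompleteNullInfinity 𝒟.toCauchyDevelopment; let Single : Literature.Geometry.Lorentzian.InitialDataSet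 (𝓡 3) X → Prop := fun D ↦ ∀ 𝒟 : Literature.Geometry.Lorentzian.VacuumCauchyDevelopment D, 𝒟.IsMaximal → ∀ [𝒟.metric.HasLeviCivita], Subsingleton (ConnectedComponents ↥(Literature.Geometry.Lorentzian.DataEmbedding.blackHoleRegion 𝒟.toDataEmbedding ∩ 𝒟.metric.causalFuture 𝒟.timeOrientation (Set.range 𝒟.embed))); let FinMany : Literature.Geometry.Lorentzian.InitialDataSet (𝓡 3) X → Prop := fun D ↦ ∀ 𝒟 : Literature.Geometry.Lorentzian.VacuumCauchyDevelopment D, 𝒟.IsMaximal → ∀ [𝒟.metric.HasLeviCivita], Finite (ConnectedComponents ↥(Literature.Geometry.Lorentzian.DataEmbedding.blackHoleRegion 𝒟.toDataEmbedding ∩ 𝒟.metric.causalFuture 𝒟.timeOrientation (Set.range 𝒟.embed))); let Equi : Literature.Geometry.Lorentzian.InitialDataSet (𝓡 3) X → Prop := fun D ↦ ∃ 𝒟 : Literature.Geometry.Lorentzian.VacuumCauchyDevelopment D, 𝒟.IsMaximal ∧ ∃ _ : 𝒟.metric.HasLeviCivita, ∃ (e : Literature.Geometry.Lorentzian.AFEnd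 X) (α : ℝ) (hα : 0 < α ∧ e.IsAsymptoticallyFlat D α) (T : Π x : 𝒟.carrier, TangentSpace (𝓡 4) x) (hT : 𝒟.metric.IsStationaryKilling 𝒟.timeOrientation T (Literature.Geometry.Lorentzian.stationaryOrbit T (𝒟.embed '' e.far (e.R + 1)))), let 𝓑 : Literature.Geometry.Lorentzian.StationaryAFBlackHole := { toSpacetime := 𝒟.toSpacetime, X := X, D := D, e := e, isAsymptoticallyFlat := ⟨α, hα⟩, embed := 𝒟.embed, normal := 𝒟.normal, isSmoothEmbedding := 𝒟.isSmoothEmbedding, isFutureUnitNormal := 𝒟.isFutureUnitNormal, induced_h := 𝒟.induced_h, induced_k := 𝒟.induced_k, killing := T, isStationary := hT }; (∃ M : ℝ, e.IsStronglyAsymptoticallyFlatDR D M) ∧ 𝓑.IsIPlusRegular ∧ 𝓑.horizon.Nonempty ∧ (∀ p ∈ 𝓑.horizon, ∃ (U : Set 𝓑.carrier) (K : Π x : 𝓑.carrier, TangentSpace (𝓡 4) x) (κ : ℝ), IsOpen U ∧ connectedComponentIn 𝓑.horizon p ⊆ U ∧ ContMDiffOn (𝓡 4) ((𝓡 4).prod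 𝓘(ℝ, Literature.Geometry.Lorentzian.E4)) ((⊤ : ℕ∞) : WithTop ℕ∞) (fun x ↦ (Bundle.TotalSpace.mk' Literature.Geometry.Lorentzian.E4 x (K x) : TangentBundle (𝓡 4) 𝓑.carrier)) U ∧ (∀ x ∈ U, ∀ v w : TangentSpace (𝓡 4) x, 𝓑.metric.val x (𝓑.metric.leviCivita K x v) w + 𝓑.metric.val x v (𝓑.metric.leviCivita K x w) = 0) ∧ (∀ x ∈ U, VectorField.mlieBracket (𝓡 4) 𝓑.killing K x = 0) ∧ (∀ q ∈ connectedComponentIn 𝓑.horizon p, K q ≠ 0) ∧ (∀ γ : ℝ → 𝓑.carrier, IsMIntegralCurve γ K → γ 0 ∈ connectedComponentIn 𝓑.horizon p → ∀ t, γ t ∈ 𝓑.horizon) ∧ κ ≠ 0 ∧ ∀ q ∈ connectedComponentIn 𝓑.horizon p, 𝓑.metric.leviCivita K q (K q) = κ • K q) ∧ ¬ IsConnected 𝓑.horizon; ∀ d ∈ Literature.Geometry.Lorentzian.admissibleVacuumData X, ¬ P d → (((¬ Disp d ∧ Trap d ∧ Cens d ∧ ¬ Pw0 d) ∧ ¬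 Single d ∧ FinMany d) ∧ Equi d) → ∃ (e : Literature.Geometry.Lorentzian.AFEnd X) (F : EuclideanSpace ℝ (Fin 1) → Literature.Geometry.Lorentzian.InitialDataSet (𝓡 3) X), Literature.Geometry.Lorentzian.InitialDataSet.IsTameDataFamily e 1 F ∧ Literature.Geometry.Lorentzian.InitialDataSet.IsImmersedAtZero 1 F ∧ F 0 = d ∧ Injective F ∧ (∀ c, F c ∈ Literature.Geometry.Lorentzian.admissibleVacuumData X) ∧ ∀ c ≠ 0, P (F c)

-- parent: MultiHoleCaptureExit · child (gen 1)
/--     item stmt-FinalStateConjecture-28687 · crux · rank 302 · open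
    parent: MultiHoleCaptureExit · by planner
    why it might fail: Stationary multi-hole exteriors outside 18557's typed class — degenerate component (κ=0; only n=2 excluded, arXiv:1111.1448), I⁺-irregular d.o.c. (CC08: assumed), 𝓔⁺/𝓑⁺ mismatch, regular exterior with dynamical interior (18557's T is GLOBAL): one with a fat exceptional neighbourhood refutes it.
    sources: arXiv:1205.6112, arXiv:1111.1448, arXiv:0806.0016, stmt-FinalStateConjecture-18557, Literature.Barriers.FinalStateConjecture.IonescuKlainermanNonExtension, Heusler1996
[crux · gen-2 cut 2/3 of MultiHoleCaptureExit (stmt-FinalStateConjecture-26646), lens-2 g5 node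
«EquilibriumCarve» · guard ∧ Stat d ∧ ¬ Equi d · THIN · WEAKER (S-implied: kernel cells_of_fsc) ·
SPECIAL-TYPE (exact EXTERIOR isometry outside 18557's typed class) · conjecturally VACUOUS · leaf
IDEA-NEEDED (the named technical-hypothesis gaps of stationary multi-hole uniqueness: degenerate
components κ = 0 — only n = 2 excluded, arXiv:1111.1448; I⁺-irregular d.o.c. — assumed in
CC08/CCH12; n ≥ 3 «widely open» CCH12 p.14; 𝓔⁺/𝓑⁺ mismatch; and the TYPING gap «18557's Killing
field is GLOBAL vs d.o.c.-local»: a CCH-regular exterior with a dynamical interior sits HERE, not in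
the 18557-killable sliver) · candidate ASIDE · does NOT count · critic R1 = INFORMATIONAL
recommendation to 18557's planner (localise the Killing equation of StationaryAFBlackHole-typed
items to closure(⟨⟨M_ext⟩⟩) ∪ horizon collars, PseudoRiemannianMetric.IsKillingFieldOn — all
CC08/CCH12 use; then the regular part of this piece closes by the same one-line kernel bridge), not
a filing] For every Σ and every admissible P_Σ-exceptional datum d of the multi-hole cell of 26646
whose development has a STATIONARY EXTERIOR (S -/
@[route_item "route-FinalStateConjecture-RootDecompHoleCountCells"]
def IrregularEquilibriumExit : Prop :=
  ∀ (X : Type) [TopologicalSpace X] [ChartedSpace Literature.Geometry.Lorentzian.E3 X] [IsManifold (𝓡 3) ((⊤ : ℕ∞) : WithTop ℕ∞) X] [T2Space X] [SecondCountableTopology X] [ConnectedSpace X], let P : Literature.Geometry.Lorentzian.InitialDataSet (𝓡 3) X → Prop := fun D ↦ (∃ 𝒟 : Literature.Geometry.Lorentzian.VacuumCauchyDevelopment D, 𝒟.IsMaximal) ∧ ∀ 𝒟 : Literature.Geometry.Lorentzian.VacuumCauchyDevelopment D, 𝒟.IsMaximal → Summit.FinalStateConjecture.HasCompleteNullInfinity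 𝒟.toCauchyDevelopment ∧ ∃ (O : Set 𝒟.carrier) (d : Literature.Geometry.Lorentzian.FinalStateDecomposition 𝒟.toSpacetime O 2), (∀ i, Literature.Geometry.Lorentzian.Kerr.IsSubextremal (d.mass i) (d.spin i)) ∧ O = Summit.FinalStateConjecture.exteriorOf 𝒟.toCauchyDevelopment d.charted ∧ Summit.FinalStateConjecture.RaysStayInClosure 𝒟.toCauchyDevelopment O ∧ Summit.FinalStateConjecture.HasExhaustiveCharts d ∧ Summit.FinalStateConjecture.IsFutureOriented d; let Pw0 : Literature.Geometry.Lorentzian.InitialDataSet (𝓡 3) X → Prop := fun D ↦ (∃ 𝒟 : Literature.Geometry.Lorentzian.VacuumCauchyDevelopment D, 𝒟.IsMaximal) ∧ ∀ 𝒟 : Literature.Geometry.Lorentzian.VacuumCauchyDevelopment D, 𝒟.IsMaximal → Summit.FinalStateConjecture.HasCompleteNullInfinity 𝒟.toCauchyDevelopment ∧ ∃ (O : Set 𝒟.carrier) (d : Literature.Geometry.Lorentzian.FinalStateDecomposition 𝒟.toSpacetime O 0), O = Summit.FinalStateConjecture.exteriorOf 𝒟.toCauchyDevelopment d.charted ∧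 Summit.FinalStateConjecture.RaysStayInClosure 𝒟.toCauchyDevelopment O ∧ Summit.FinalStateConjecture.HasExhaustiveCharts d ∧ Summit.FinalStateConjecture.IsFutureOriented d; let Disp : Literature.Geometry.Lorentzian.InitialDataSet (𝓡 3) X → Prop := fun D ↦ (∃ 𝒟 : Literature.Geometry.Lorentzian.VacuumCauchyDevelopment D, 𝒟.IsMaximal) ∧ ∀ 𝒟 : Literature.Geometry.Lorentzian.VacuumCauchyDevelopment D, 𝒟.IsMaximal → ∀ [𝒟.metric.HasLeviCivita], ¬ 𝒟.metric.IsFutureNullGeodesicallyIncomplete 𝒟.timeOrientation ∧ ¬ 𝒟.metric.IsFutureTimelikeGeodesicallyIncomplete 𝒟.timeOrientation; let Trap : Literature.Geometry.Lorentzian.InitialDataSet (𝓡 3) X → Prop := fun D ↦ (∃ 𝒟 : Literature.Geometry.Lorentzian.VacuumCauchyDevelopment D, 𝒟.IsMaximal) ∧ ∀ 𝒟 : Literature.Geometry.Lorentzian.VacuumCauchyDevelopment D, 𝒟.IsMaximal → ∀ [𝒟.metric.HasLeviCivita], ∃ f : Metric.sphere (0 : Literature.Geometry.Lorentzian.E3)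 1 → 𝒟.carrier, Set.range f ⊆ 𝒟.metric.causalFuture 𝒟.timeOrientation (Set.range 𝒟.embed) ∧ 𝒟.metric.IsTrappedSurface (𝓡 2) 𝒟.timeOrientation f; let Cens : Literature.Geometry.Lorentzian.InitialDataSet (𝓡 3) X → Prop := fun D ↦ ∀ 𝒟 : Literature.Geometry.Lorentzian.VacuumCauchyDevelopment D, 𝒟.IsMaximal → Summit.FinalStateConjecture.HasCompleteNullInfinity 𝒟.toCauchyDevelopment; let Single : Literature.Geometry.Lorentzian.InitialDataSet (𝓡 3) X → Prop := fun D ↦ ∀ 𝒟 : Literature.Geometry.Lorentzian.VacuumCauchyDevelopment D, 𝒟.IsMaximal → ∀ [𝒟.metric.HasLeviCivita], Subsingleton (ConnectedComponents ↥(Literature.Geometry.Lorentzian.DataEmbedding.blackHoleRegion 𝒟.toDataEmbedding ∩ 𝒟.metric.causalFuture 𝒟.timeOrientation (Set.range 𝒟.embed))); let FinMany : Literature.Geometry.Lorentzian.InitialDataSet (𝓡 3) X → Prop := fun D ↦ ∀ 𝒟 : Literature.Geometry.Lorentzian.VacuumCauchyDevelopment D, 𝒟.IsMaximal → ∀ [𝒟.metric.HasLeviCivita],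 Finite (ConnectedComponents ↥(Literature.Geometry.Lorentzian.DataEmbedding.blackHoleRegion 𝒟.toDataEmbedding ∩ 𝒟.metric.causalFuture 𝒟.timeOrientation (Set.range 𝒟.embed))); let Stat : Literature.Geometry.Lorentzian.InitialDataSet (𝓡 3) X → Prop := fun D ↦ ∃ 𝒟 : Literature.Geometry.Lorentzian.VacuumCauchyDevelopment D, 𝒟.IsMaximal ∧ ∃ _ : 𝒟.metric.HasLeviCivita, ∃ (e : Literature.Geometry.Lorentzian.AFEnd X) (T : Π x : 𝒟.carrier, TangentSpace (𝓡 4) x), (∃ M : ℝ, e.IsStronglyAsymptoticallyFlatDR D M) ∧ (∀ x ∈ 𝒟.embed '' e.far (e.R + 1), ∃ γ : ℝ → 𝒟.carrier, IsMIntegralCurve γ T ∧ γ 0 = x) ∧ 𝒟.metric.toPseudoRiemannianMetric.IsKillingFieldOn T (𝒟.metric.docOfEnd 𝒟.timeOrientation (Literature.Geometry.Lorentzian.stationaryOrbit T (𝒟.embed '' e.far (e.R + 1)))) ∧ ∀ x ∈ Literature.Geometry.Lorentzian.stationaryOrbit T (𝒟.embed '' e.far (e.R + 1)), 𝒟.metric.IsTimelike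 (T x) ∧ 𝒟.timeOrientation.IsFutureDirected (T x); let Equi : Literature.Geometry.Lorentzian.InitialDataSet (𝓡 3) X → Prop := fun D ↦ ∃ 𝒟 : Literature.Geometry.Lorentzian.VacuumCauchyDevelopment D, 𝒟.IsMaximal ∧ ∃ _ : 𝒟.metric.HasLeviCivita, ∃ (e : Literature.Geometry.Lorentzian.AFEnd X) (α : ℝ) (hα : 0 < α ∧ e.IsAsymptoticallyFlat D α) (T : Π x : 𝒟.carrier, TangentSpace (𝓡 4) x) (hT : 𝒟.metric.IsStationaryKilling 𝒟.timeOrientation T (Literature.Geometry.Lorentzian.stationaryOrbit T (𝒟.embed '' e.far (e.R + 1)))), let 𝓑 : Literature.Geometry.Lorentzian.StationaryAFBlackHole := { toSpacetime := 𝒟.toSpacetime, X := X, D := D, e := e, isAsymptoticallyFlat := ⟨α, hα⟩, embed := 𝒟.embed, normal := 𝒟.normal, isSmoothEmbedding := 𝒟.isSmoothEmbedding, isFutureUnitNormal := 𝒟.isFutureUnitNormal, induced_h := 𝒟.induced_h, induced_k := 𝒟.induced_k, killing := T, isStationary := hT }; (∃ M : ℝ, e.IsStronglyAsymptoticallyFlatDR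 D M) ∧ 𝓑.IsIPlusRegular ∧ 𝓑.horizon.Nonempty ∧ (∀ p ∈ 𝓑.horizon, ∃ (U : Set 𝓑.carrier) (K : Π x : 𝓑.carrier, TangentSpace (𝓡 4) x) (κ : ℝ), IsOpen U ∧ connectedComponentIn 𝓑.horizon p ⊆ U ∧ ContMDiffOn (𝓡 4) ((𝓡 4).prod 𝓘(ℝ, Literature.Geometry.Lorentzian.E4)) ((⊤ : ℕ∞) : WithTop ℕ∞) (fun x ↦ (Bundle.TotalSpace.mk' Literature.Geometry.Lorentzian.E4 x (K x) : TangentBundle (𝓡 4) 𝓑.carrier)) U ∧ (∀ x ∈ U, ∀ v w : TangentSpace (𝓡 4) x, 𝓑.metric.val x (𝓑.metric.leviCivita K x v) w + 𝓑.metric.val x v (𝓑.metric.leviCivita K x w) = 0) ∧ (∀ x ∈ U, VectorField.mlieBracket (𝓡 4) 𝓑.killing K x = 0) ∧ (∀ q ∈ connectedComponentIn 𝓑.horizon p, K q ≠ 0) ∧ (∀ γ : ℝ → 𝓑.carrier, IsMIntegralCurve γ K → γ 0 ∈ connectedComponentIn 𝓑.horizon p → ∀ t, γ t ∈ 𝓑.horizon)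 ∧ κ ≠ 0 ∧ ∀ q ∈ connectedComponentIn 𝓑.horizon p, 𝓑.metric.leviCivita K q (K q) = κ • K q) ∧ ¬ IsConnected 𝓑.horizon; ∀ d ∈ Literature.Geometry.Lorentzian.admissibleVacuumData X, ¬ P d → (((¬ Disp d ∧ Trap d ∧ Cens d ∧ ¬ Pw0 d) ∧ ¬ Single d ∧ FinMany d) ∧ Stat d ∧ ¬ Equi d) → ∃ (e : Literature.Geometry.Lorentzian.AFEnd X) (F : EuclideanSpace ℝ (Fin 1) → Literature.Geometry.Lorentzian.InitialDataSet (𝓡 3) X), Literature.Geometry.Lorentzian.InitialDataSet.IsTameDataFamily e 1 F ∧ Literature.Geometry.Lorentzian.InitialDataSet.IsImmersedAtZero 1 F ∧ F 0 = d ∧ Injective F ∧ (∀ c, F c ∈ Literature.Geometry.Lorentzian.admissibleVacuumData X) ∧ ∀ c ≠ 0, P (F c)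

-- parent: MultiHoleCaptureExit · child (gen 1)
/--     item stmt-FinalStateConjecture-28688 · crux · rank 303 · open
    parent: MultiHoleCaptureExit · by planner
    why it might fail: A tame-fat set of censored trapped data, nowhere exterior-stationary, ending with ≥2 holes that neither merge nor settle — eternal radiating binary (periodic ⇒ stationary near 𝓘⁺, Alexakis–Schlue), receding holes with rough exteriors, approach to an irregular equilibrium exterior; no N≥2 theorem.
    sources: arXiv:1504.04592, stmt-FinalStateConjecture-10993, stmt-FinalStateConjecture-10082, stmt-FinalStateConjecture-14310, arXiv:2104.11857, galaxy:panama:491722215784459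
[crux · gen-2 cut 3/3 of MultiHoleCaptureExit (stmt-FinalStateConjecture-26646), lens-2 g5 node
«EquilibriumCarve» · guard ∧ ¬ Stat d · WEAKER (S-implied: kernel cells_of_fsc; ⇏ parent: silent on
every datum with a stationary exterior) · NEW RESIDUAL = 26646 relieved of every equilibrium
EXTERIOR by construction (strictly weaker exactly by the multi-horizon-uniqueness conjectures;
interior-surgery test passed: perturbing an equilibrium datum inside its holes changes neither
⟨⟨M_ext⟩⟩ nor its P_Σ-status, so disguised equilibria stay on the special side) · GENERIC-TYPE ·
INSTRUMENTABLE (NR binary / N-body phenomenology; census T36–T38) · PARKED internal node (critic R2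
accepted: no further cut without a norm-matched N ≥ 2 rung — none in print; instrument first) ·
COUNTS (the one counting piece of the split)] For every Σ and every admissible P_Σ-exceptional datum
d of the multi-hole cell of 26646 NONE of whose MGHDs has a stationary exterior (¬ Stat d: no
Killing field on the domain of outer communications of a DR-SAF end, complete from the far region
and future-timelike there), there are one end e and a tame (order 1 at e), immersed-at-0, injective
one-parameter family F of admissibl -/
@[route_item "route-FinalStateConjecture-RootDecompHoleCountCells"]
def DynamicalMultiHoleExit : Prop :=
  ∀ (X : Type) [TopologicalSpace X] [ChartedSpace Literature.Geometry.Lorentzian.E3 X] [IsManifold (𝓡 3) ((⊤ : ℕ∞) : WithTop ℕ∞) X] [T2Space X] [SecondCountableTopology X] [ConnectedSpace X], let P : Literature.Geometry.Lorentzian.InitialDataSet (𝓡 3) X → Prop := fun D ↦ (∃ 𝒟 : Literature.Geometry.Lorentzian.VacuumCauchyDevelopment D, 𝒟.IsMaximal) ∧ ∀ 𝒟 : Literature.Geometry.Lorentzian.VacuumCauchyDevelopment D, 𝒟.IsMaximal → Summit.FinalStateConjecture.HasCompleteNullInfinity 𝒟.toCauchyDevelopment ∧ ∃ (O : Set 𝒟.carrier)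 (d : Literature.Geometry.Lorentzian.FinalStateDecomposition 𝒟.toSpacetime O 2), (∀ i, Literature.Geometry.Lorentzian.Kerr.IsSubextremal (d.mass i) (d.spin i)) ∧ O = Summit.FinalStateConjecture.exteriorOf 𝒟.toCauchyDevelopment d.charted ∧ Summit.FinalStateConjecture.RaysStayInClosure 𝒟.toCauchyDevelopment O ∧ Summit.FinalStateConjecture.HasExhaustiveCharts d ∧ Summit.FinalStateConjecture.IsFutureOriented d; let Pw0 : Literature.Geometry.Lorentzian.InitialDataSet (𝓡 3) X → Prop := fun D ↦ (∃ 𝒟 : Literature.Geometry.Lorentzian.VacuumCauchyDevelopment D, 𝒟.IsMaximal) ∧ ∀ 𝒟 : Literature.Geometry.Lorentzian.VacuumCauchyDevelopment D, 𝒟.IsMaximal → Summit.FinalStateConjecture.HasCompleteNullInfinity 𝒟.toCauchyDevelopment ∧ ∃ (O : Set 𝒟.carrier) (d : Literature.Geometry.Lorentzian.FinalStateDecomposition 𝒟.toSpacetime O 0), O = Summit.FinalStateConjecture.exteriorOf 𝒟.toCauchyDevelopment d.charted ∧ Summit.FinalStateConjecture.RaysStayInClosure 𝒟.toCauchyDevelopment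 O ∧ Summit.FinalStateConjecture.HasExhaustiveCharts d ∧ Summit.FinalStateConjecture.IsFutureOriented d; let Disp : Literature.Geometry.Lorentzian.InitialDataSet (𝓡 3) X → Prop := fun D ↦ (∃ 𝒟 : Literature.Geometry.Lorentzian.VacuumCauchyDevelopment D, 𝒟.IsMaximal) ∧ ∀ 𝒟 : Literature.Geometry.Lorentzian.VacuumCauchyDevelopment D, 𝒟.IsMaximal → ∀ [𝒟.metric.HasLeviCivita], ¬ 𝒟.metric.IsFutureNullGeodesicallyIncomplete 𝒟.timeOrientation ∧ ¬ 𝒟.metric.IsFutureTimelikeGeodesicallyIncomplete 𝒟.timeOrientation; let Trap : Literature.Geometry.Lorentzian.InitialDataSet (𝓡 3) X → Prop := fun D ↦ (∃ 𝒟 : Literature.Geometry.Lorentzian.VacuumCauchyDevelopment D, 𝒟.IsMaximal) ∧ ∀ 𝒟 : Literature.Geometry.Lorentzian.VacuumCauchyDevelopment D, 𝒟.IsMaximal → ∀ [𝒟.metric.HasLeviCivita], ∃ f : Metric.sphere (0 : Literature.Geometry.Lorentzian.E3) 1 → 𝒟.carrier, Set.range f ⊆ 𝒟.metric.causalFuture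 𝒟.timeOrientation (Set.range 𝒟.embed) ∧ 𝒟.metric.IsTrappedSurface (𝓡 2) 𝒟.timeOrientation f; let Cens : Literature.Geometry.Lorentzian.InitialDataSet (𝓡 3) X → Prop := fun D ↦ ∀ 𝒟 : Literature.Geometry.Lorentzian.VacuumCauchyDevelopment D, 𝒟.IsMaximal → Summit.FinalStateConjecture.HasCompleteNullInfinity 𝒟.toCauchyDevelopment; let Single : Literature.Geometry.Lorentzian.InitialDataSet (𝓡 3) X → Prop := fun D ↦ ∀ 𝒟 : Literature.Geometry.Lorentzian.VacuumCauchyDevelopment D, 𝒟.IsMaximal → ∀ [𝒟.metric.HasLeviCivita], Subsingleton (ConnectedComponents ↥(Literature.Geometry.Lorentzian.DataEmbedding.blackHoleRegion 𝒟.toDataEmbedding ∩ 𝒟.metric.causalFuture 𝒟.timeOrientation (Set.range 𝒟.embed))); let FinMany : Literature.Geometry.Lorentzian.InitialDataSet (𝓡 3) X → Prop := fun D ↦ ∀ 𝒟 : Literature.Geometry.Lorentzian.VacuumCauchyDevelopment D, 𝒟.IsMaximal → ∀ [𝒟.metric.HasLeviCivita], Finite (ConnectedComponents ↥(Literature.Geometry.Lorentzian.DataEmbedding.blackHoleRegion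 𝒟.toDataEmbedding ∩ 𝒟.metric.causalFuture 𝒟.timeOrientation (Set.range 𝒟.embed))); let Stat : Literature.Geometry.Lorentzian.InitialDataSet (𝓡 3) X → Prop := fun D ↦ ∃ 𝒟 : Literature.Geometry.Lorentzian.VacuumCauchyDevelopment D, 𝒟.IsMaximal ∧ ∃ _ : 𝒟.metric.HasLeviCivita, ∃ (e : Literature.Geometry.Lorentzian.AFEnd X) (T : Π x : 𝒟.carrier, TangentSpace (𝓡 4) x), (∃ M : ℝ, e.IsStronglyAsymptoticallyFlatDR D M) ∧ (∀ x ∈ 𝒟.embed '' e.far (e.R + 1), ∃ γ : ℝ → 𝒟.carrier, IsMIntegralCurve γ T ∧ γ 0 = x) ∧ 𝒟.metric.toPseudoRiemannianMetric.IsKillingFieldOn T (𝒟.metric.docOfEnd 𝒟.timeOrientation (Literature.Geometry.Lorentzian.stationaryOrbit T (𝒟.embed '' e.far (e.R + 1)))) ∧ ∀ x ∈ Literature.Geometry.Lorentzian.stationaryOrbit T (𝒟.embed '' e.far (e.R + 1)), 𝒟.metric.IsTimelike (T x) ∧ 𝒟.timeOrientation.IsFutureDirected (T x); ∀ d ∈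 Literature.Geometry.Lorentzian.admissibleVacuumData X, ¬ P d → (((¬ Disp d ∧ Trap d ∧ Cens d ∧ ¬ Pw0 d) ∧ ¬ Single d ∧ FinMany d) ∧ ¬ Stat d) → ∃ (e : Literature.Geometry.Lorentzian.AFEnd X) (F : EuclideanSpace ℝ (Fin 1) → Literature.Geometry.Lorentzian.InitialDataSet (𝓡 3) X), Literature.Geometry.Lorentzian.InitialDataSet.IsTameDataFamily e 1 F ∧ Literature.Geometry.Lorentzian.InitialDataSet.IsImmersedAtZero 1 F ∧ F 0 = d ∧ Injective F ∧ (∀ c, F c ∈ Literature.Geometry.Lorentzian.admissibleVacuumData X) ∧ ∀ c ≠ 0, P (F c)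

-- parent: MultiHoleCaptureExit · glue (gen 1)
/--     item stmt-FinalStateConjecture-28689 · support · rank 304 · open
    parent: MultiHoleCaptureExit · GLUE: children ⟹ parent · by planner
RegularEquilibriumExit → IrregularEquilibriumExit → DynamicalMultiHoleExit → MultiHoleCaptureExit -/
@[route_item "route-FinalStateConjecture-RootDecompHoleCountCells"]
def MultiHoleCaptureExitGlue : Prop :=
  RegularEquilibriumExit → IrregularEquilibriumExit → DynamicalMultiHoleExit → MultiHoleCaptureExit

/-- item stmt-FinalStateConjecture-26647 · crux · rank 4 · open · by planner
why it might fail: Late-time tails refocusing through an already formed hole's strong field (caustics near photon spheres) could keep forming ever smaller holes at ever later times on a tame-open set; no statement either way is in print (arXiv:2210.13960 p.6).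
sources: arXiv:0805.3880, arXiv:1409.6270, Christodoulou1999, arXiv:0811.0354, arXiv:2210.13960, HawkingEllis1973
[crux · child 𝓣₂^∞ of TrappedCaptureExit · thin · conjecturally EMPTY · IDEA-NEEDED; CLEARED by
decomp-fsc-crit-1-g0 2026-08-30T03:23:32Z (k = 3 chosen); writer glue/exactness
folder/n2bg3/Sketch.lean rc 0 / 0 sorry.] For every Σ and every admissible P_Σ-exceptional datum d
of the capture cell 𝓣₂ (not of dispersive type; every MGHD contains a closed trapped sphere in the
causal future of the data; every MGHD has complete future null infinity; d fails the weak C⁰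
property P_w⁰) SOME of whose MGHDs ends with INFINITELY MANY black holes (¬ Finite
(ConnectedComponents ↥𝓑⁺)), there are one end e and a tame (order 1 at e), immersed-at-0, injective
one-parameter family F of admissible data with F 0 = d all of whose members c ≠ 0 satisfy P_Σ. It
isolates the clause «N : ℕ» (finitely many hole charts) of FinalStateDecomposition inside the
censored trapped basin. Kill path: a quantitative converse of trapped-surface formation (no closed
trapped surface in a region uniformly C¹-close to Minkowski) + late-time decay of the exterior field
⟹ no hole forms after some slab ⟹ finitely many components; classical vacuum has no mass gap
(Christodoulou short pulse arXiv:0805.3880, An–Luk arXiv:1409.627 -/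
@[route_item "route-FinalStateConjecture-RootDecompHoleCountCells", crux]
def InfiniteHoleCaptureExit : Prop :=
  ∀ (X : Type) [TopologicalSpace X] [ChartedSpace Literature.Geometry.Lorentzian.E3 X] [IsManifold (𝓡 3) ((⊤ : ℕ∞) : WithTop ℕ∞) X] [T2Space X] [SecondCountableTopology X] [ConnectedSpace X], let P : Literature.Geometry.Lorentzian.InitialDataSet (𝓡 3) X → Prop := fun D ↦ (∃ 𝒟 : Literature.Geometry.Lorentzian.VacuumCauchyDevelopment D, 𝒟.IsMaximal) ∧ ∀ 𝒟 : Literature.Geometry.Lorentzian.VacuumCauchyDevelopment D, 𝒟.IsMaximal → Summit.FinalStateConjecture.HasCompleteNullInfinity 𝒟.toCauchyDevelopment ∧ ∃ (O : Set 𝒟.carrier) (d : Literature.Geometry.Lorentzian.FinalStateDecomposition 𝒟.toSpacetime O 2), (∀ i, Literature.Geometry.Lorentzian.Kerr.IsSubextremal (d.mass i) (d.spin i)) ∧ O = Summit.FinalStateConjecture.exteriorOf 𝒟.toCauchyDevelopment d.charted ∧ Summit.FinalStateConjecture.RaysStayInClosure 𝒟.toCauchyDevelopment O ∧ Summit.FinalStateConjecture.HasExhaustiveCharts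 d ∧ Summit.FinalStateConjecture.IsFutureOriented d; let Pw0 : Literature.Geometry.Lorentzian.InitialDataSet (𝓡 3) X → Prop := fun D ↦ (∃ 𝒟 : Literature.Geometry.Lorentzian.VacuumCauchyDevelopment D, 𝒟.IsMaximal) ∧ ∀ 𝒟 : Literature.Geometry.Lorentzian.VacuumCauchyDevelopment D, 𝒟.IsMaximal → Summit.FinalStateConjecture.HasCompleteNullInfinity 𝒟.toCauchyDevelopment ∧ ∃ (O : Set 𝒟.carrier) (d : Literature.Geometry.Lorentzian.FinalStateDecomposition 𝒟.toSpacetime O 0), O = Summit.FinalStateConjecture.exteriorOf 𝒟.toCauchyDevelopment d.charted ∧ Summit.FinalStateConjecture.RaysStayInClosure 𝒟.toCauchyDevelopment O ∧ Summit.FinalStateConjecture.HasExhaustiveCharts d ∧ Summit.FinalStateConjecture.IsFutureOriented d; let Disp : Literature.Geometry.Lorentzian.InitialDataSet (𝓡 3) X → Prop := fun D ↦ (∃ 𝒟 : Literature.Geometry.Lorentzian.VacuumCauchyDevelopment D, 𝒟.IsMaximal) ∧ ∀ 𝒟 : Literature.Geometry.Lorentzian.VacuumCauchyDevelopment D, 𝒟.IsMaximal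 → ∀ [𝒟.metric.HasLeviCivita], ¬ 𝒟.metric.IsFutureNullGeodesicallyIncomplete 𝒟.timeOrientation ∧ ¬ 𝒟.metric.IsFutureTimelikeGeodesicallyIncomplete 𝒟.timeOrientation; let Trap : Literature.Geometry.Lorentzian.InitialDataSet (𝓡 3) X → Prop := fun D ↦ (∃ 𝒟 : Literature.Geometry.Lorentzian.VacuumCauchyDevelopment D, 𝒟.IsMaximal) ∧ ∀ 𝒟 : Literature.Geometry.Lorentzian.VacuumCauchyDevelopment D, 𝒟.IsMaximal → ∀ [𝒟.metric.HasLeviCivita], ∃ f : Metric.sphere (0 : Literature.Geometry.Lorentzian.E3) 1 → 𝒟.carrier, Set.range f ⊆ 𝒟.metric.causalFuture 𝒟.timeOrientation (Set.range 𝒟.embed) ∧ 𝒟.metric.IsTrappedSurface (𝓡 2) 𝒟.timeOrientation f; let Cens : Literature.Geometry.Lorentzian.InitialDataSet (𝓡 3) X → Prop := fun D ↦ ∀ 𝒟 : Literature.Geometry.Lorentzian.VacuumCauchyDevelopment D, 𝒟.IsMaximal → Summit.FinalStateConjecture.HasCompleteNullInfinity 𝒟.toCauchyDevelopment; let FinMany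 : Literature.Geometry.Lorentzian.InitialDataSet (𝓡 3) X → Prop := fun D ↦ ∀ 𝒟 : Literature.Geometry.Lorentzian.VacuumCauchyDevelopment D, 𝒟.IsMaximal → ∀ [𝒟.metric.HasLeviCivita], Finite (ConnectedComponents ↥(Literature.Geometry.Lorentzian.DataEmbedding.blackHoleRegion 𝒟.toDataEmbedding ∩ 𝒟.metric.causalFuture 𝒟.timeOrientation (Set.range 𝒟.embed))); ∀ d ∈ Literature.Geometry.Lorentzian.admissibleVacuumData X, ¬ P d → ((¬ Disp d ∧ Trap d ∧ Cens d ∧ ¬ Pw0 d) ∧ ¬ FinMany d) → ∃ (e : Literature.Geometry.Lorentzian.AFEnd X) (F : EuclideanSpace ℝ (Fin 1) → Literature.Geometry.Lorentzian.InitialDataSet (𝓡 3) X), Literature.Geometry.Lorentzian.InitialDataSet.IsTameDataFamily e 1 F ∧ Literature.Geometry.Lorentzian.InitialDataSet.IsImmersedAtZero 1 F ∧ F 0 = d ∧ Injective F ∧ (∀ c, F c ∈ Literature.Geometry.Lorentzian.admissibleVacuumData X) ∧ ∀ c ≠ 0, P (F c)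

/-- item stmt-FinalStateConjecture-25598 · crux · rank 5 · open · by planner
why it might fail: a tame-open set of admissible vacuum data whose MGHD traps a sphere AND forms a naked singularity outside the resulting black hole (smooth-data analogue of the Hölder-class stability arXiv:2605.16235), or incompleteness of 𝓘⁺ generated by the black-hole region itself on an open set.
sources: doi:10.1088/0264-9381/22/11/019, arXiv:2402.10190, arXiv:2211.15742, arXiv:1912.08478, arXiv:2204.09891, arXiv:1407.4766
[crux] PIECE 𝓣₁ — TrappedNakedExit [WEAKER·COUNTS·SPECIAL-TYPE — critic CLEARED
2026-08-30T02:40:09Z; weak cosmic censorship AFTER trapping (cell empty in the spherical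
scalar-field model doi:10.1088/0264-9381/22/11/019, expected codim ≥ 1 in vacuum); subsumes lens-5's
TrappedNakedCell (critic ruling); leaf IDEA-NEEDED; BARRIER-adjacent nakedSingularityInstability
honoured as the cure]. For every Σ and every admissible P_Σ-exceptional datum d, not of dispersive
type, all of whose MGHDs contain a closed trapped sphere to the future of the data, and SOME of
whose MGHDs has incomplete future null infinity (weak cosmic censorship fails in the presence of a
trapped sphere), there are one end e and a tame immersed injective one-parameter family F of
admissible data with F 0 = d whose members c ≠ 0 satisfy P_Σ. Model: the cell is EMPTY for
spherically symmetric Einstein–Maxwell–scalar field / Einstein–Vlasov (Dafermos 2005; Rendall 2008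
§11.5); in vacuum 3+1 expected inhabited (naked-singularity datum superposed with a distant
collapsing region by localized gluing) with positive codimension. [difficulty: open-problem] -/
@[route_item "route-FinalStateConjecture-RootDecompHoleCountCells", crux]
def TrappedNakedExit : Prop :=
  ∀ (X : Type) [TopologicalSpace X] [ChartedSpace Literature.Geometry.Lorentzian.E3 X] [IsManifold (𝓡 3) ((⊤ : ℕ∞) : WithTop ℕ∞) X] [T2Space X] [SecondCountableTopology X] [ConnectedSpace X], let P : Literature.Geometry.Lorentzian.InitialDataSet (𝓡 3) X → Prop := fun D ↦ (∃ 𝒟 : Literature.Geometry.Lorentzian.VacuumCauchyDevelopment D, 𝒟.IsMaximal) ∧ ∀ 𝒟 : Literature.Geometry.Lorentzian.VacuumCauchyDevelopment D, 𝒟.IsMaximal → Summit.FinalStateConjecture.HasCompleteNullInfinity 𝒟.toCauchyDevelopment ∧ ∃ (O : Set 𝒟.carrier) (d : Literature.Geometry.Lorentzian.FinalStateDecomposition 𝒟.toSpacetime O 2), (∀ i, Literature.Geometry.Lorentzian.Kerr.IsSubextremal (d.mass i) (d.spin i)) ∧ O = Summit.FinalStateConjecture.exteriorOf 𝒟.toCauchyDevelopment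 d.charted ∧ Summit.FinalStateConjecture.RaysStayInClosure 𝒟.toCauchyDevelopment O ∧ Summit.FinalStateConjecture.HasExhaustiveCharts d ∧ Summit.FinalStateConjecture.IsFutureOriented d; let Disp : Literature.Geometry.Lorentzian.InitialDataSet (𝓡 3) X → Prop := fun D ↦ (∃ 𝒟 : Literature.Geometry.Lorentzian.VacuumCauchyDevelopment D, 𝒟.IsMaximal) ∧ ∀ 𝒟 : Literature.Geometry.Lorentzian.VacuumCauchyDevelopment D, 𝒟.IsMaximal → ∀ [𝒟.metric.HasLeviCivita], ¬ 𝒟.metric.IsFutureNullGeodesicallyIncomplete 𝒟.timeOrientation ∧ ¬ 𝒟.metric.IsFutureTimelikeGeodesicallyIncomplete 𝒟.timeOrientation; let Trap : Literature.Geometry.Lorentzian.InitialDataSet (𝓡 3) X → Prop := fun D ↦ (∃ 𝒟 : Literature.Geometry.Lorentzian.VacuumCauchyDevelopment D, 𝒟.IsMaximal) ∧ ∀ 𝒟 : Literature.Geometry.Lorentzian.VacuumCauchyDevelopment D, 𝒟.IsMaximal → ∀ [𝒟.metric.HasLeviCivita], ∃ f : Metric.sphere (0 : Literature.Geometry.Lorentzian.E3)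 1 → 𝒟.carrier, Set.range f ⊆ 𝒟.metric.causalFuture 𝒟.timeOrientation (Set.range 𝒟.embed) ∧ 𝒟.metric.IsTrappedSurface (𝓡 2) 𝒟.timeOrientation f; let Cens : Literature.Geometry.Lorentzian.InitialDataSet (𝓡 3) X → Prop := fun D ↦ ∀ 𝒟 : Literature.Geometry.Lorentzian.VacuumCauchyDevelopment D, 𝒟.IsMaximal → Summit.FinalStateConjecture.HasCompleteNullInfinity 𝒟.toCauchyDevelopment; ∀ d ∈ Literature.Geometry.Lorentzian.admissibleVacuumData X, ¬ P d → (¬ Disp d ∧ Trap d ∧ ¬ Cens d) → ∃ (e : Literature.Geometry.Lorentzian.AFEnd X) (F : EuclideanSpace ℝ (Fin 1) → Literature.Geometry.Lorentzian.InitialDataSet (𝓡 3) X), Literature.Geometry.Lorentzian.InitialDataSet.IsTameDataFamily e 1 F ∧ Literature.Geometry.Lorentzian.InitialDataSet.IsImmersedAtZero 1 F ∧ F 0 = d ∧ Injective F ∧ (∀ c, F c ∈ Literature.Geometry.Lorentzian.admissibleVacuumData X) ∧ ∀ c ≠ 0, P (F c)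

/-- item stmt-FinalStateConjecture-25599 · crux · rank 6 · open · by planner
why it might fail: the set of trapped data with exactly extremal remnants could be tame-thick (accumulating on itself along every tame line through a member), or every tame exit from it could pass through uncensored data; vacuum extremal Kerr formation itself is open (arXiv:2402.10190 p.12).
sources: arXiv:2211.15742, arXiv:2402.10190, arXiv:2304.08455, Aretakis2015, arXiv:1402.7034, Israel1986
[crux] PIECE 𝓣₃ — TrappedExtremalExit [WEAKER·COUNTS·SPECIAL-TYPE — critic CLEARED
2026-08-30T02:40:09Z; generic THIRD LAW after trapping (transversal crossing of |a_f|/M_f = 1 along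
a tame line) + pointwise C⁰→C² upgrade at sub-extremal members (content pinned by
stmt-FinalStateConjecture-17298 SubextremalUpgrade, cited by name); MODEL-ANALOGUE in print not a
rung (arXiv:2211.15742 Thm 1); INSTRUMENTABLE (remnant-spin census); BARRIER AretakisInstability
OUTSIDE (asks to leave the cell)]. For every Σ and every admissible P_Σ-exceptional datum d, not of
dispersive type, all of whose MGHDs contain a closed trapped sphere to the future of the data, and
which SATISFIES the weak C⁰ property P_w⁰ (an MGHD exists; every MGHD has complete 𝓘⁺ and an honest
C⁰ Kerr final-state decomposition with |a_i| ≤ M_i and the Statement's four clauses) — so that,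
given the registered pointwise upgrade stmt-17298, d fails P_Σ exactly because one of its MGHDs has
only end states with an exactly extremal hole — there are one end e and a tame immersed injective
one-parameter family F of admissible data with F 0 = d whose members c ≠ 0 satisfy P_Σ. Content: the
generic third law after trapping (final |a_f|/ -/
@[route_item "route-FinalStateConjecture-RootDecompHoleCountCells", crux]
def TrappedExtremalExit : Prop :=
  ∀ (X : Type) [TopologicalSpace X] [ChartedSpace Literature.Geometry.Lorentzian.E3 X] [IsManifold (𝓡 3) ((⊤ : ℕ∞) : WithTop ℕ∞) X] [T2Space X] [SecondCountableTopology X] [ConnectedSpace X], let P : Literature.Geometry.Lorentzian.InitialDataSet (𝓡 3) X → Prop := fun D ↦ (∃ 𝒟 : Literature.Geometry.Lorentzian.VacuumCauchyDevelopment D, 𝒟.IsMaximal) ∧ ∀ 𝒟 : Literature.Geometry.Lorentzian.VacuumCauchyDevelopment D, 𝒟.IsMaximal → Summit.FinalStateConjecture.HasCompleteNullInfinity 𝒟.toCauchyDevelopment ∧ ∃ (O : Set 𝒟.carrier) (d : Literature.Geometry.Lorentzian.FinalStateDecomposition 𝒟.toSpacetime O 2), (∀ i, Literature.Geometry.Lorentzian.Kerr.IsSubextremal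 (d.mass i) (d.spin i)) ∧ O = Summit.FinalStateConjecture.exteriorOf 𝒟.toCauchyDevelopment d.charted ∧ Summit.FinalStateConjecture.RaysStayInClosure 𝒟.toCauchyDevelopment O ∧ Summit.FinalStateConjecture.HasExhaustiveCharts d ∧ Summit.FinalStateConjecture.IsFutureOriented d; let Pw0 : Literature.Geometry.Lorentzian.InitialDataSet (𝓡 3) X → Prop := fun D ↦ (∃ 𝒟 : Literature.Geometry.Lorentzian.VacuumCauchyDevelopment D, 𝒟.IsMaximal) ∧ ∀ 𝒟 : Literature.Geometry.Lorentzian.VacuumCauchyDevelopment D, 𝒟.IsMaximal → Summit.FinalStateConjecture.HasCompleteNullInfinity 𝒟.toCauchyDevelopment ∧ ∃ (O : Set 𝒟.carrier) (d : Literature.Geometry.Lorentzian.FinalStateDecomposition 𝒟.toSpacetime O 0), O = Summit.FinalStateConjecture.exteriorOf 𝒟.toCauchyDevelopment d.charted ∧ Summit.FinalStateConjecture.RaysStayInClosure 𝒟.toCauchyDevelopment O ∧ Summit.FinalStateConjecture.HasExhaustiveCharts d ∧ Summit.FinalStateConjecture.IsFutureOriented d; let Disp : Literature.Geometry.Lorentzian.InitialDataSet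 (𝓡 3) X → Prop := fun D ↦ (∃ 𝒟 : Literature.Geometry.Lorentzian.VacuumCauchyDevelopment D, 𝒟.IsMaximal) ∧ ∀ 𝒟 : Literature.Geometry.Lorentzian.VacuumCauchyDevelopment D, 𝒟.IsMaximal → ∀ [𝒟.metric.HasLeviCivita], ¬ 𝒟.metric.IsFutureNullGeodesicallyIncomplete 𝒟.timeOrientation ∧ ¬ 𝒟.metric.IsFutureTimelikeGeodesicallyIncomplete 𝒟.timeOrientation; let Trap : Literature.Geometry.Lorentzian.InitialDataSet (𝓡 3) X → Prop := fun D ↦ (∃ 𝒟 : Literature.Geometry.Lorentzian.VacuumCauchyDevelopment D, 𝒟.IsMaximal) ∧ ∀ 𝒟 : Literature.Geometry.Lorentzian.VacuumCauchyDevelopment D, 𝒟.IsMaximal → ∀ [𝒟.metric.HasLeviCivita], ∃ f : Metric.sphere (0 : Literature.Geometry.Lorentzian.E3) 1 → 𝒟.carrier, Set.range f ⊆ 𝒟.metric.causalFuture 𝒟.timeOrientation (Set.range 𝒟.embed) ∧ 𝒟.metric.IsTrappedSurface (𝓡 2) 𝒟.timeOrientation f; ∀ d ∈ Literature.Geometry.Lorentzian.admissibleVacuumData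 X, ¬ P d → (¬ Disp d ∧ Trap d ∧ Pw0 d) → ∃ (e : Literature.Geometry.Lorentzian.AFEnd X) (F : EuclideanSpace ℝ (Fin 1) → Literature.Geometry.Lorentzian.InitialDataSet (𝓡 3) X), Literature.Geometry.Lorentzian.InitialDataSet.IsTameDataFamily e 1 F ∧ Literature.Geometry.Lorentzian.InitialDataSet.IsImmersedAtZero 1 F ∧ F 0 = d ∧ Injective F ∧ (∀ c, F c ∈ Literature.Geometry.Lorentzian.admissibleVacuumData X) ∧ ∀ c ≠ 0, P (F c)

/-- item stmt-FinalStateConjecture-24765 · crux · rank 7 · open · by planner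
why it might fail: the extremal critical set B_crit could be thick in the tame topology (extremal thresholds accumulating on themselves along every tame line), or leaving the threshold could land in naked data; vacuum extremal formation itself is open (arXiv:2402.10190 p.12).
sources: arXiv:2402.10190, arXiv:2211.15742, arXiv:2304.08455
[crux] PIECE 𝓝∧P_w — ExtremalThresholdExit [WEAKER·thin — critic CLEARED 2026-08-30T01:39:13Z with
retag: the printed Kehle–Unger exit family (arXiv:2402.10190 Thm 1, Einstein–Maxwell–Vlasov) is a
MODEL-ANALOGUE, not a rung; leaf IDEA-NEEDED; BARRIER placement: AretakisInstability concerns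
settling ON the threshold, this piece only asks to LEAVE it along a tame curve — outside; the bet is
transversality of B_crit]. For every Σ and every admissible P_Σ-exceptional datum d of threshold
type (not dispersive, not trapped) which satisfies the WEAK property P_w (an MGHD exists; every MGHD
has complete 𝓘⁺ and a Kerr final state decomposition with all the Statement's clauses but only |aᵢ|
≤ Mᵢ — so d fails P_Σ only through an exactly extremal final hole), there are one end e and a tame
immersed injective one-parameter family F of admissible data with F 0 = d whose members c ≠ 0
satisfy P_Σ. [difficulty: open-problem] -/
@[route_item "route-FinalStateConjecture-RootDecompHoleCountCells", crux]
def ExtremalThresholdExit : Prop :=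
  ∀ (X : Type) [TopologicalSpace X] [ChartedSpace Literature.Geometry.Lorentzian.E3 X] [IsManifold (𝓡 3) ((⊤ : ℕ∞) : WithTop ℕ∞) X] [T2Space X] [SecondCountableTopology X] [ConnectedSpace X], let P : Literature.Geometry.Lorentzian.InitialDataSet (𝓡 3) X → Prop := fun D ↦ (∃ 𝒟 : Literature.Geometry.Lorentzian.VacuumCauchyDevelopment D, 𝒟.IsMaximal) ∧ ∀ 𝒟 : Literature.Geometry.Lorentzian.VacuumCauchyDevelopment D, 𝒟.IsMaximal → Summit.FinalStateConjecture.HasCompleteNullInfinity 𝒟.toCauchyDevelopment ∧ ∃ (O : Set 𝒟.carrier) (d : Literature.Geometry.Lorentzian.FinalStateDecomposition 𝒟.toSpacetime O 2), (∀ i, Literature.Geometry.Lorentzian.Kerr.IsSubextremal (d.mass i) (d.spin i)) ∧ O = Summit.FinalStateConjecture.exteriorOf 𝒟.toCauchyDevelopment d.charted ∧ Summit.FinalStateConjecture.RaysStayInClosure 𝒟.toCauchyDevelopment O ∧ Summit.FinalStateConjecture.HasExhaustiveCharts d ∧ Summit.FinalStateConjecture.IsFutureOriented d; let Pw : Literature.Geometry.Lorentzian.InitialDataSet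 (𝓡 3) X → Prop := fun D ↦ (∃ 𝒟 : Literature.Geometry.Lorentzian.VacuumCauchyDevelopment D, 𝒟.IsMaximal) ∧ ∀ 𝒟 : Literature.Geometry.Lorentzian.VacuumCauchyDevelopment D, 𝒟.IsMaximal → Summit.FinalStateConjecture.HasCompleteNullInfinity 𝒟.toCauchyDevelopment ∧ ∃ (O : Set 𝒟.carrier) (d : Literature.Geometry.Lorentzian.FinalStateDecomposition 𝒟.toSpacetime O 2), O = Summit.FinalStateConjecture.exteriorOf 𝒟.toCauchyDevelopment d.charted ∧ Summit.FinalStateConjecture.RaysStayInClosure 𝒟.toCauchyDevelopment O ∧ Summit.FinalStateConjecture.HasExhaustiveCharts d ∧ Summit.FinalStateConjecture.IsFutureOriented d; let Disp : Literature.Geometry.Lorentzian.InitialDataSet (𝓡 3) X → Prop := fun D ↦ (∃ 𝒟 : Literature.Geometry.Lorentzian.VacuumCauchyDevelopment D, 𝒟.IsMaximal) ∧ ∀ 𝒟 : Literature.Geometry.Lorentzian.VacuumCauchyDevelopment D, 𝒟.IsMaximal → ∀ [𝒟.metric.HasLeviCivita], ¬ 𝒟.metric.IsFutureNullGeodesicallyIncomplete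 𝒟.timeOrientation ∧ ¬ 𝒟.metric.IsFutureTimelikeGeodesicallyIncomplete 𝒟.timeOrientation; let Trap : Literature.Geometry.Lorentzian.InitialDataSet (𝓡 3) X → Prop := fun D ↦ (∃ 𝒟 : Literature.Geometry.Lorentzian.VacuumCauchyDevelopment D, 𝒟.IsMaximal) ∧ ∀ 𝒟 : Literature.Geometry.Lorentzian.VacuumCauchyDevelopment D, 𝒟.IsMaximal → ∀ [𝒟.metric.HasLeviCivita], ∃ f : Metric.sphere (0 : Literature.Geometry.Lorentzian.E3) 1 → 𝒟.carrier, Set.range f ⊆ 𝒟.metric.causalFuture 𝒟.timeOrientation (Set.range 𝒟.embed) ∧ 𝒟.metric.IsTrappedSurface (𝓡 2) 𝒟.timeOrientation f; ∀ d ∈ Literature.Geometry.Lorentzian.admissibleVacuumData X, ¬ P d → (¬ Disp d ∧ ¬ Trap d ∧ Pw d) → ∃ (e : Literature.Geometry.Lorentzian.AFEnd X) (F : EuclideanSpace ℝ (Fin 1) → Literature.Geometry.Lorentzian.InitialDataSet (𝓡 3) X), Literature.Geometry.Lorentzian.InitialDataSet.IsTameDataFamily e 1 F ∧ Literature.Geometry.Lorentzian.InitialDataSet.IsImmersedAtZero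 1 F ∧ F 0 = d ∧ Injective F ∧ (∀ c, F c ∈ Literature.Geometry.Lorentzian.admissibleVacuumData X) ∧ ∀ c ≠ 0, P (F c)

/-- item stmt-FinalStateConjecture-24766 · crux · rank 8 · open · by planner
why it might fail: a non-radiating vacuum breather or a complete development with curvature not decaying at i⁺ whose tame neighbours are also exceptional (an open set) refutes it; no-breather results hold only near 𝓘 (arXiv:1504.04592) or for decaying solutions (arXiv:2108.13379).
sources: arXiv:2108.13379, arXiv:1504.04592, doi:10.1007/PL00001021
[crux] PIECE 𝓒 — DispersiveExit [WEAKER·thin — critic CLEARED 2026-08-30T01:39:13Z; implied outright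
by the registered pointwise item stmt-FinalStateConjecture-17320
`NoParkingWithoutHorizon.CompleteSpacetimesDisperse` (lens kernel
`dispersiveExit_of_completeSpacetimesDisperse`; cited by name, not re-typed); leaf IDEA-NEEDED;
attackable-now sub-rung: stationary-complete ⇒ flat (Lichnerowicz–Anderson port); rung stmt-10029
NoVacuumBreathers]. For every Σ and every admissible P_Σ-exceptional datum d of dispersive type (an
MGHD exists and every MGHD is future causally geodesically complete: no future null or timelike
geodesic incompleteness, stated under the metric's Levi-Civita instance), there are one end e and a
tame immersed injective one-parameter family F of admissible data with F 0 = d whose members c ≠ 0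
satisfy P_Σ. [difficulty: open-problem] -/
@[route_item "route-FinalStateConjecture-RootDecompHoleCountCells", crux]
def DispersiveExit : Prop :=
  ∀ (X : Type) [TopologicalSpace X] [ChartedSpace Literature.Geometry.Lorentzian.E3 X] [IsManifold (𝓡 3) ((⊤ : ℕ∞) : WithTop ℕ∞) X] [T2Space X] [SecondCountableTopology X] [ConnectedSpace X], let P : Literature.Geometry.Lorentzian.InitialDataSet (𝓡 3) X → Prop := fun D ↦ (∃ 𝒟 : Literature.Geometry.Lorentzian.VacuumCauchyDevelopment D, 𝒟.IsMaximal) ∧ ∀ 𝒟 : Literature.Geometry.Lorentzian.VacuumCauchyDevelopment D, 𝒟.IsMaximal → Summit.FinalStateConjecture.HasCompleteNullInfinity 𝒟.toCauchyDevelopment ∧ ∃ (O : Set 𝒟.carrier) (d : Literature.Geometry.Lorentzian.FinalStateDecomposition 𝒟.toSpacetime O 2), (∀ i, Literature.Geometry.Lorentzian.Kerr.IsSubextremal (d.mass i) (d.spin i)) ∧ O = Summit.FinalStateConjecture.exteriorOf 𝒟.toCauchyDevelopment d.charted ∧ Summit.FinalStateConjecture.RaysStayInClosure 𝒟.toCauchyDevelopment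 O ∧ Summit.FinalStateConjecture.HasExhaustiveCharts d ∧ Summit.FinalStateConjecture.IsFutureOriented d; let Disp : Literature.Geometry.Lorentzian.InitialDataSet (𝓡 3) X → Prop := fun D ↦ (∃ 𝒟 : Literature.Geometry.Lorentzian.VacuumCauchyDevelopment D, 𝒟.IsMaximal) ∧ ∀ 𝒟 : Literature.Geometry.Lorentzian.VacuumCauchyDevelopment D, 𝒟.IsMaximal → ∀ [𝒟.metric.HasLeviCivita], ¬ 𝒟.metric.IsFutureNullGeodesicallyIncomplete 𝒟.timeOrientation ∧ ¬ 𝒟.metric.IsFutureTimelikeGeodesicallyIncomplete 𝒟.timeOrientation; ∀ d ∈ Literature.Geometry.Lorentzian.admissibleVacuumData X, ¬ P d → Disp d → ∃ (e : Literature.Geometry.Lorentzian.AFEnd X) (F : EuclideanSpace ℝ (Fin 1) → Literature.Geometry.Lorentzian.InitialDataSet (𝓡 3) X), Literature.Geometry.Lorentzian.InitialDataSet.IsTameDataFamily e 1 F ∧ Literature.Geometry.Lorentzian.InitialDataSet.IsImmersedAtZero 1 F ∧ F 0 = d ∧ Injective F ∧ (∀ c, F c ∈ Literature.Geometry.Lorentzian.admissibleVacuumData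 X) ∧ ∀ c ≠ 0, P (F c)

/-- item stmt-FinalStateConjecture-24767 · support · rank 9 · open · by planner
why it might fail: a smooth-data analogue of the Singh–Zheng stability — a tame-open set of admissible vacuum data forming naked singularities (RSR arXiv:1912.08478 exteriors are fine-tuned, consistent so far).
sources: Christodoulou1999, arXiv:1912.08478, arXiv:2204.09891, arXiv:2605.16235, arXiv:0811.0354
[crux] PIECE 𝓝∧¬P_w — NakedThresholdExit [WEAKER·COUNTS — critic CLEARED 2026-08-30T01:39:13Z; =
weak cosmic censorship on the untrapped incomplete sector in Christodoulou's own codimension form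
(the all-cells version is the registered hard core stmt-FinalStateConjecture-17269, cited; this is
its cell restriction with cure target P_Σ); leaf IDEA-NEEDED; BARRIER: nakedSingularityInstability
is the MODEL exit family (Christodoulou1999 Thm 4.1, 2-plane of exits) = the generic form, outside
the genericity-blind class; functional-framework dependence (Singh–Zheng arXiv:2605.16235:
Hölder-stable naked singularities in the spherical scalar field) — the bet is that smooth tame data
are on the unstable side]. For every Σ and every admissible P_Σ-exceptional datum d of threshold
type (not dispersive, not trapped) failing even the weak property P_w (no MGHD, or an MGHD with
incomplete 𝓘⁺, or censored but settling to no Kerr configuration with |aᵢ| ≤ Mᵢ), there are one end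
e and a tame immersed injective one-parameter family F of admissible data with F 0 = d whose members
c ≠ 0 satisfy P_Σ. [difficulty: open-problem] -/
@[route_item "route-FinalStateConjecture-RootDecompHoleCountCells", crux]
def NakedThresholdExit : Prop :=
  ∀ (X : Type) [TopologicalSpace X] [ChartedSpace Literature.Geometry.Lorentzian.E3 X] [IsManifold (𝓡 3) ((⊤ : ℕ∞) : WithTop ℕ∞) X] [T2Space X] [SecondCountableTopology X] [ConnectedSpace X], let P : Literature.Geometry.Lorentzian.InitialDataSet (𝓡 3) X → Prop := fun D ↦ (∃ 𝒟 : Literature.Geometry.Lorentzian.VacuumCauchyDevelopment D, 𝒟.IsMaximal) ∧ ∀ 𝒟 : Literature.Geometry.Lorentzian.VacuumCauchyDevelopment D, 𝒟.IsMaximal → Summit.FinalStateConjecture.HasCompleteNullInfinity 𝒟.toCauchyDevelopment ∧ ∃ (O : Set 𝒟.carrier) (d : Literature.Geometry.Lorentzian.FinalStateDecomposition 𝒟.toSpacetime O 2), (∀ i, Literature.Geometry.Lorentzian.Kerr.IsSubextremal (d.mass i) (d.spin i)) ∧ O = Summit.FinalStateConjecture.exteriorOf 𝒟.toCauchyDevelopment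 d.charted ∧ Summit.FinalStateConjecture.RaysStayInClosure 𝒟.toCauchyDevelopment O ∧ Summit.FinalStateConjecture.HasExhaustiveCharts d ∧ Summit.FinalStateConjecture.IsFutureOriented d; let Pw : Literature.Geometry.Lorentzian.InitialDataSet (𝓡 3) X → Prop := fun D ↦ (∃ 𝒟 : Literature.Geometry.Lorentzian.VacuumCauchyDevelopment D, 𝒟.IsMaximal) ∧ ∀ 𝒟 : Literature.Geometry.Lorentzian.VacuumCauchyDevelopment D, 𝒟.IsMaximal → Summit.FinalStateConjecture.HasCompleteNullInfinity 𝒟.toCauchyDevelopment ∧ ∃ (O : Set 𝒟.carrier) (d : Literature.Geometry.Lorentzian.FinalStateDecomposition 𝒟.toSpacetime O 2), O = Summit.FinalStateConjecture.exteriorOf 𝒟.toCauchyDevelopment d.charted ∧ Summit.FinalStateConjecture.RaysStayInClosure 𝒟.toCauchyDevelopment O ∧ Summit.FinalStateConjecture.HasExhaustiveCharts d ∧ Summit.FinalStateConjecture.IsFutureOriented d; let Disp : Literature.Geometry.Lorentzian.InitialDataSet (𝓡 3) X → Prop := fun D ↦ (∃ 𝒟 : Literature.Geometry.Lorentzian.VacuumCauchyDevelopment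 D, 𝒟.IsMaximal) ∧ ∀ 𝒟 : Literature.Geometry.Lorentzian.VacuumCauchyDevelopment D, 𝒟.IsMaximal → ∀ [𝒟.metric.HasLeviCivita], ¬ 𝒟.metric.IsFutureNullGeodesicallyIncomplete 𝒟.timeOrientation ∧ ¬ 𝒟.metric.IsFutureTimelikeGeodesicallyIncomplete 𝒟.timeOrientation; let Trap : Literature.Geometry.Lorentzian.InitialDataSet (𝓡 3) X → Prop := fun D ↦ (∃ 𝒟 : Literature.Geometry.Lorentzian.VacuumCauchyDevelopment D, 𝒟.IsMaximal) ∧ ∀ 𝒟 : Literature.Geometry.Lorentzian.VacuumCauchyDevelopment D, 𝒟.IsMaximal → ∀ [𝒟.metric.HasLeviCivita], ∃ f : Metric.sphere (0 : Literature.Geometry.Lorentzian.E3) 1 → 𝒟.carrier, Set.range f ⊆ 𝒟.metric.causalFuture 𝒟.timeOrientation (Set.range 𝒟.embed) ∧ 𝒟.metric.IsTrappedSurface (𝓡 2) 𝒟.timeOrientation f; ∀ d ∈ Literature.Geometry.Lorentzian.admissibleVacuumData X, ¬ P d → (¬ Disp d ∧ ¬ Trap d ∧ ¬ Pw d) → ∃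 (e : Literature.Geometry.Lorentzian.AFEnd X) (F : EuclideanSpace ℝ (Fin 1) → Literature.Geometry.Lorentzian.InitialDataSet (𝓡 3) X), Literature.Geometry.Lorentzian.InitialDataSet.IsTameDataFamily e 1 F ∧ Literature.Geometry.Lorentzian.InitialDataSet.IsImmersedAtZero 1 F ∧ F 0 = d ∧ Injective F ∧ (∀ c, F c ∈ Literature.Geometry.Lorentzian.admissibleVacuumData X) ∧ ∀ c ≠ 0, P (F c)

/-- item stmt-FinalStateConjecture-27590 · assembly · rank 1 · open · by planner
sources: doi:10.1103/PhysRevLett.14.57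
[assembly] SingleHoleCaptureExit → MultiHoleCaptureExit → InfiniteHoleCaptureExit → TrappedNakedExit
→ TrappedExtremalExit → ExtremalThresholdExit → DispersiveExit → NakedThresholdExit → the final
state conjecture as typed. -/
@[route_item "route-FinalStateConjecture-RootDecompHoleCountCells"]
def Assembly : Prop :=
  SingleHoleCaptureExit → MultiHoleCaptureExit → InfiniteHoleCaptureExit → TrappedNakedExit → TrappedExtremalExit → ExtremalThresholdExit → DispersiveExit → NakedThresholdExit → FinalStateConjecture

/-! D-0027 §2.1 — DECIDING THEOREM (planner-authored via `route open/edit --closes-file`; by planner-decomp-fsc-writer-1-g0-0 2026-08-30T04:22:02Z):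
its hypotheses are this route's items and its conclusion the sub-problem Statement (glue_lint), and it elaborates with this file. -/

@[closes "route-FinalStateConjecture-RootDecompHoleCountCells"] theorem closes (hSingle : SingleHoleCaptureExit) (hMulti : MultiHoleCaptureExit) (hInf : InfiniteHoleCaptureExit) (t₁ : TrappedNakedExit) (t₃ : TrappedExtremalExit) (h₃ : ExtremalThresholdExit) (h₁ : DispersiveExit) (h₄ : NakedThresholdExit) : _root_.FinalStateConjecture := by
  have t₂ : ∀ (X : Type) [TopologicalSpace X] [ChartedSpace Literature.Geometry.Lorentzian.E3 X] [IsManifold (𝓡 3) ((⊤ : ℕ∞) : WithTop ℕ∞) X] [T2Space X] [SecondCountableTopology X] [ConnectedSpace X], let P : Literature.Geometry.Lorentzian.InitialDataSet (𝓡 3) X → Prop := fun D ↦ (∃ 𝒟 : Literature.Geometry.Lorentzian.VacuumCauchyDevelopment D, 𝒟.IsMaximal) ∧ ∀ 𝒟 : Literature.Geometry.Lorentzian.VacuumCauchyDevelopment D, 𝒟.IsMaximal → Summit.FinalStateConjecture.HasCompleteNullInfinity 𝒟.toCauchyDevelopment ∧ ∃ (O : Set 𝒟.carrier) (d : Literature.Geometry.Lorentzian.FinalStateDecomposition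 𝒟.toSpacetime O 2), (∀ i, Literature.Geometry.Lorentzian.Kerr.IsSubextremal (d.mass i) (d.spin i)) ∧ O = Summit.FinalStateConjecture.exteriorOf 𝒟.toCauchyDevelopment d.charted ∧ Summit.FinalStateConjecture.RaysStayInClosure 𝒟.toCauchyDevelopment O ∧ Summit.FinalStateConjecture.HasExhaustiveCharts d ∧ Summit.FinalStateConjecture.IsFutureOriented d; let Pw0 : Literature.Geometry.Lorentzian.InitialDataSet (𝓡 3) X → Prop := fun D ↦ (∃ 𝒟 : Literature.Geometry.Lorentzian.VacuumCauchyDevelopment D, 𝒟.IsMaximal) ∧ ∀ 𝒟 : Literature.Geometry.Lorentzian.VacuumCauchyDevelopment D, 𝒟.IsMaximal → Summit.FinalStateConjecture.HasCompleteNullInfinity 𝒟.toCauchyDevelopment ∧ ∃ (O : Set 𝒟.carrier) (d : Literature.Geometry.Lorentzian.FinalStateDecomposition 𝒟.toSpacetime O 0), O = Summit.FinalStateConjecture.exteriorOf 𝒟.toCauchyDevelopment d.charted ∧ Summit.FinalStateConjecture.RaysStayInClosure 𝒟.toCauchyDevelopment O ∧ Summit.FinalStateConjecture.HasExhaustiveCharts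 d ∧ Summit.FinalStateConjecture.IsFutureOriented d; let Disp : Literature.Geometry.Lorentzian.InitialDataSet (𝓡 3) X → Prop := fun D ↦ (∃ 𝒟 : Literature.Geometry.Lorentzian.VacuumCauchyDevelopment D, 𝒟.IsMaximal) ∧ ∀ 𝒟 : Literature.Geometry.Lorentzian.VacuumCauchyDevelopment D, 𝒟.IsMaximal → ∀ [𝒟.metric.HasLeviCivita], ¬ 𝒟.metric.IsFutureNullGeodesicallyIncomplete 𝒟.timeOrientation ∧ ¬ 𝒟.metric.IsFutureTimelikeGeodesicallyIncomplete 𝒟.timeOrientation; let Trap : Literature.Geometry.Lorentzian.InitialDataSet (𝓡 3) X → Prop := fun D ↦ (∃ 𝒟 : Literature.Geometry.Lorentzian.VacuumCauchyDevelopment D, 𝒟.IsMaximal) ∧ ∀ 𝒟 : Literature.Geometry.Lorentzian.VacuumCauchyDevelopment D, 𝒟.IsMaximal → ∀ [𝒟.metric.HasLeviCivita], ∃ f : Metric.sphere (0 : Literature.Geometry.Lorentzian.E3) 1 → 𝒟.carrier, Set.range f ⊆ 𝒟.metric.causalFuture 𝒟.timeOrientation (Set.range 𝒟.embed) ∧ 𝒟.metric.IsTrappedSurface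 (𝓡 2) 𝒟.timeOrientation f; let Cens : Literature.Geometry.Lorentzian.InitialDataSet (𝓡 3) X → Prop := fun D ↦ ∀ 𝒟 : Literature.Geometry.Lorentzian.VacuumCauchyDevelopment D, 𝒟.IsMaximal → Summit.FinalStateConjecture.HasCompleteNullInfinity 𝒟.toCauchyDevelopment; ∀ d ∈ Literature.Geometry.Lorentzian.admissibleVacuumData X, ¬ P d → (¬ Disp d ∧ Trap d ∧ Cens d ∧ ¬ Pw0 d) → ∃ (e : Literature.Geometry.Lorentzian.AFEnd X) (F : EuclideanSpace ℝ (Fin 1) → Literature.Geometry.Lorentzian.InitialDataSet (𝓡 3) X), Literature.Geometry.Lorentzian.InitialDataSet.IsTameDataFamily e 1 F ∧ Literature.Geometry.Lorentzian.InitialDataSet.IsImmersedAtZero 1 F ∧ F 0 = d ∧ Injective F ∧ (∀ c, F c ∈ Literature.Geometry.Lorentzian.admissibleVacuumData X) ∧ ∀ c ≠ 0, P (F c) := by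
    intro X _ _ _ _ _ _ P Pw0 Disp Trap Cens d hd hP hcell
    exact (Classical.em _).elim (fun hS ↦ hSingle X d hd hP ⟨hcell, hS⟩)
      (fun hS ↦ (Classical.em _).elim (fun hF ↦ hMulti X d hd hP ⟨hcell, hS, hF⟩) (fun hF ↦ hInf X d hd hP ⟨hcell, hF⟩))
  intro X _ _ _ _ _ _ d hd
  suffices h : ∃ (e : Literature.Geometry.Lorentzian.AFEnd X) (F : EuclideanSpace ℝ (Fin 1) → Literature.Geometry.Lorentzian.InitialDataSet (𝓡 3) X), Literature.Geometry.Lorentzian.InitialDataSet.IsTameDataFamily e 1 F ∧ Literature.Geometry.Lorentzian.InitialDataSet.IsImmersedAtZero 1 F ∧ F 0 = d ∧ Injective F ∧ (∀ c, F c ∈ Literature.Geometry.Lorentzian.admissibleVacuumData X) ∧ ∀ c ≠ 0, ((∃ 𝒟 : Literature.Geometry.Lorentzian.VacuumCauchyDevelopment (F c), 𝒟.IsMaximal) ∧ ∀ 𝒟 : Literature.Geometry.Lorentzian.VacuumCauchyDevelopment (F c), 𝒟.IsMaximal → Summit.FinalStateConjecture.HasCompleteNullInfinity 𝒟.toCauchyDevelopment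 ∧ ∃ (O : Set 𝒟.carrier) (d : Literature.Geometry.Lorentzian.FinalStateDecomposition 𝒟.toSpacetime O 2), (∀ i, Literature.Geometry.Lorentzian.Kerr.IsSubextremal (d.mass i) (d.spin i)) ∧ O = Summit.FinalStateConjecture.exteriorOf 𝒟.toCauchyDevelopment d.charted ∧ Summit.FinalStateConjecture.RaysStayInClosure 𝒟.toCauchyDevelopment O ∧ Summit.FinalStateConjecture.HasExhaustiveCharts d ∧ Summit.FinalStateConjecture.IsFutureOriented d) by
    obtain ⟨e, F, h1, h2, h3, h4, h5, h6⟩ := h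
    exact ⟨e, F, h1, h2, h3, h4, h5, fun c hc hmem ↦ hmem.2 (h6 c hc)⟩
  by_cases hD : (∃ 𝒟 : Literature.Geometry.Lorentzian.VacuumCauchyDevelopment d, 𝒟.IsMaximal) ∧ ∀ 𝒟 : Literature.Geometry.Lorentzian.VacuumCauchyDevelopment d, 𝒟.IsMaximal → ∀ [𝒟.metric.HasLeviCivita], ¬ 𝒟.metric.IsFutureNullGeodesicallyIncomplete 𝒟.timeOrientation ∧ ¬ 𝒟.metric.IsFutureTimelikeGeodesicallyIncomplete 𝒟.timeOrientation
  · exact h₁ X d hd.1 hd.2 hD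
  by_cases hT : (∃ 𝒟 : Literature.Geometry.Lorentzian.VacuumCauchyDevelopment d, 𝒟.IsMaximal) ∧ ∀ 𝒟 : Literature.Geometry.Lorentzian.VacuumCauchyDevelopment d, 𝒟.IsMaximal → ∀ [𝒟.metric.HasLeviCivita], ∃ f : Metric.sphere (0 : Literature.Geometry.Lorentzian.E3) 1 → 𝒟.carrier, Set.range f ⊆ 𝒟.metric.causalFuture 𝒟.timeOrientation (Set.range 𝒟.embed) ∧ 𝒟.metric.IsTrappedSurface (𝓡 2) 𝒟.timeOrientation f
  · by_cases hW0 : (fun D ↦ (∃ 𝒟 : Literature.Geometry.Lorentzian.VacuumCauchyDevelopment D, 𝒟.IsMaximal) ∧ ∀ 𝒟 : Literature.Geometry.Lorentzian.VacuumCauchyDevelopment D, 𝒟.IsMaximal → Summit.FinalStateConjecture.HasCompleteNullInfinity 𝒟.toCauchyDevelopment ∧ ∃ (O : Set 𝒟.carrier) (d : Literature.Geometry.Lorentzian.FinalStateDecomposition 𝒟.toSpacetime O 0), O = Summit.FinalStateConjecture.exteriorOf 𝒟.toCauchyDevelopment d.charted ∧ Summit.FinalStateConjecture.RaysStayInClosure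 𝒟.toCauchyDevelopment O ∧ Summit.FinalStateConjecture.HasExhaustiveCharts d ∧ Summit.FinalStateConjecture.IsFutureOriented d) d
    · exact t₃ X d hd.1 hd.2 ⟨hD, hT, hW0⟩
    by_cases hC : (fun D ↦ ∀ 𝒟 : Literature.Geometry.Lorentzian.VacuumCauchyDevelopment D, 𝒟.IsMaximal → Summit.FinalStateConjecture.HasCompleteNullInfinity 𝒟.toCauchyDevelopment) d
    · exact t₂ X d hd.1 hd.2 ⟨hD, hT, hC, hW0⟩
    · exact t₁ X d hd.1 hd.2 ⟨hD, hT, hC⟩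
  by_cases hW : (∃ 𝒟 : Literature.Geometry.Lorentzian.VacuumCauchyDevelopment d, 𝒟.IsMaximal) ∧ ∀ 𝒟 : Literature.Geometry.Lorentzian.VacuumCauchyDevelopment d, 𝒟.IsMaximal → Summit.FinalStateConjecture.HasCompleteNullInfinity 𝒟.toCauchyDevelopment ∧ ∃ (O : Set 𝒟.carrier) (d : Literature.Geometry.Lorentzian.FinalStateDecomposition 𝒟.toSpacetime O 2), O = Summit.FinalStateConjecture.exteriorOf 𝒟.toCauchyDevelopment d.charted ∧ Summit.FinalStateConjecture.RaysStayInClosure 𝒟.toCauchyDevelopment O ∧ Summit.FinalStateConjecture.HasExhaustiveCharts d ∧ Summit.FinalStateConjecture.IsFutureOriented d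
  · exact h₃ X d hd.1 hd.2 ⟨hD, hT, hW⟩
  · exact h₄ X d hd.1 hd.2 ⟨hD, hT, hW⟩

end Summit.FinalStateConjecture.FinalStateConjecture.Theses.RootDecompHoleCountCells
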